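import Literature.NumberTheory.LFunctions.GuthMaynardEnergyLemma
import HarnessLib

/-!
# Guth–Maynard Proposition 8.1 (the simple `S₃` bound), proved along §8 of the paper

NOT RH-BEARING (D-0040; bears_on LADDER-RH §4 HELD `DensityLadder`): a large-values / zero-density result
counts zeros off the critical line, it never empties the strip
(`Literature.Barriers.RiemannHypothesis.LindelofBacklund`); nothing in this file bears on the truth of RH.

Topic `NumberTheory/LFunctions`. L. Guth, J. Maynard, *New large value estimates for Dirichlet
polynomials*, Ann. of Math. (2) 203 (2026) = arXiv:2405.20552, **Proposition 8.1** (`S₃` controlled by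
the energy): "If `W` is a `T^ε`-separated set contained in an interval of length `T`, then
`S₃ ⪅_ε T²|W|^{1/2}E(W)^{1/2}`." Here `S₃ = GuthMaynardFourier.S3 w N W` (§7 of the paper,
`LargeValuesTraceExpansion.lean`), `E(W) = GuthMaynardAssembly.addEnergy W` ((2.3) of the paper), and
`w` is the cutoff fixed in §3 of the paper. The main theorem `GuthMaynardSimpleS3.S3_simple_bound` is the
statement AS PRINTED with `T` free: for all `T ≥ T₀(ε, δ)`, all `1 ≤ N ≤ T` (the large-values regime of
§3, "we may assume `N < T`") and every `T^ε`-separated `W` in an interval of length `T`,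
`|S₃| ≤ C T^δ · T²|W|^{1/2}E(W)^{1/2}`. The tree's statement `GuthMaynard2026_proposition_8_1`
(`GuthMaynardEnergyLemma.lean`) is the special case `T = N^{6/5}` (the standing regime of Proposition 3.1,
binder shape of Proposition 10.1 `GuthMaynardS3Final.S3_bound`); it was discharged there from the STRONGER
Proposition 10.1, and its docstring records the free-`T` reading as `TODO(general form)` and the printed
§8 proof as "not reproduced". This file does both: `S3_simple_bound` is the free-`T` form (the tree's §§7–10
files bound `S₃` only for `T = N^{6/5}`), proved along §8, and `GuthMaynard2026_proposition_8_1_holds'` is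
the resulting second proof of the typed statement.

## The printed proof and its formalisation

The proof of Proposition 8.1 (p. 17 of the arXiv version) reads: start from Proposition 7.2
(`S₃ ⪅ (N²/M) ∑_m Ĩ_m`), apply Hölder to `∫ |R(v₁)| R̃(A_m v₁) R̃(B_m v₁) dv₁`, change variables
`u = (m₁v₁ + m₃)/(m₂v₁)` (Jacobian `≍ 1`) and `u = (m₁v₁ + m₃)/m₂` (Jacobian `≍ M/M₁`), and insert
Lemma 8.2 (`∫|R|² ≪ |W|`), Lemma 8.3 (`∫|R̃|⁴ ⪅ E(W)`) and `M ⪅ T/N`. It is formalised on top of the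
tree's dyadic-block machinery for Proposition 7.2 (written for Proposition 10.1), as follows.

* Proposition 7.2, one term / one dyadic block `shell i₁ × shell i₂ × shell i₃` of `𝓜³`:
  `GuthMaynardS3Loc.norm_Im_le_localised`, `GuthMaynardS3Blocks.block_sum_le_snd` / `_fst` (the block
  is localised in the larger of `|m₁|, |m₂|`; blocks with `|m₃| ≥ 32 max(|m₁|,|m₂|)` are negligible,
  `GuthMaynardS3Blocks.majorant_le_of_far_block`).
* Hölder: `GuthMaynardS3Blocks.setIntegral_sum_sqrt_mul_le` (Cauchy–Schwarz twice, inside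
  `block_main_le`), which leaves `(∫ g_W)^{1/2} · (4J(f_B; ·))^{1/4} · J(f_B; ·)^{1/4}` with the
  smoothed mean square `f_B = φ_B ⋆ g_W` of `R` (`LargeValuesSmoothedR.lean`, the paper's `R̃²`).
* Change of variables: the TRIVIAL bound `GuthMaynardAffine.Jfun_trivial` for
  `J(f) = ∫ (∑ f((m₁u+m₃)/m₂))²` — Cauchy–Schwarz over `(m₁, m₂, m₃)` and `∫ F(au+b) du = |a|⁻¹∫F`
  with `|a|⁻¹ ≤ 2M₂/M₁` (the paper's "Jacobian factor of norm `≍ M/M₁`"; the substitution `u = 1/v` for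
  the `A_m` factor is inside `GuthMaynardS3Blocks.setIntegral_sq_sum_affA_le`). This replaces the deep
  Proposition 9.1 (`GuthMaynardAffine.affine_equidistribution`) used at the same place for
  Proposition 10.1 — exactly the difference between §8 and §10 of the paper.
* Lemma 8.2: `GuthMaynardSmoothR.integral_gW_le_card` (`∫ g_W ≪ |W|`, `1`-separated `W`); Lemma 8.3:
  `GuthMaynardSmoothR.integral_fB_sq_le` + `integral_gW_sq_le_energy`
  (`∫ f_B² ≤ ‖ψ₁‖₁² ∫ g_W² ≪ N^η E(W) + N^{η(1−j)}|W|⁴`).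
* `M ⪅ T/N`: the truncation `S₃ = ∑_{m ∈ 𝓜³_{M₀}} I_m + O(T²|W|^{3/2})`, `NM₀ ≍ TN^η` ((7.2) of the
  paper; `trunc_total_freeT`, the `T`-free version of `GuthMaynardS3Final.trunc_total`), and the
  arithmetic `N²M² ≤ 9T²N^{2η}` in `simple_block_alg`.
* The range `N⁶ ≤ T` (where the `N^{-ηj}` error terms of the localisation are not `T`-negligible) is
  covered by the trivial bound `|S₃| ≪ N³|W|³ ≤ T^{1/2}|W|³ ≪ T²|W|^{1/2}E(W)^{1/2}`
  (`norm_S3_le_trivial`: `|B_N(τ)| ≪ 1` by Poisson summation, `GuthMaynardFourier.sum_weight_sq_cpow_eq`).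
  Throughout, `|W|² ≤ E(W)` (`GuthMaynardEnergyBound.card_sq_le_energy`) converts `|W|^{3/2}` into
  `|W|^{1/2}E(W)^{1/2}`, and the `T^ε`-separation is used only through `1`-separation.

"`⪅`" is rendered as `∀ δ > 0, ∃ C T₀, … ≤ C T^δ · (…)` (conventions §1.2 of the paper). No definition
and no named fact is introduced; everything in this file is proved. Deliberately NOT here: Proposition 10.1
with `T` free (the blocks above would need Proposition 9.1 in place of `Jfun_trivial`).

## References

* L. Guth, J. Maynard, *New large value estimates for Dirichlet polynomials*, Ann. of Math. (2) 203
  (2026), no. 2, 623–675; arXiv:2405.20552 (2024): §7 ((7.2), Propositions 7.1–7.2), §8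
  (Proposition 8.1, Lemmas 8.2–8.3 and the proof of Proposition 8.1, p. 17), Remark after
  Proposition 9.1 (the trivial bound for `J(f)`). [key `GuthMaynard2026`]
-/

noncomputable section

open Finset hiding addEnergy
open Real Set Filter MeasureTheory Complex
open scoped FourierTransform ContDiff Convolution

namespace Literature.NumberTheory.LFunctions

namespace GuthMaynardSimpleS3

open GuthMaynardFourier GuthMaynardRFunction GuthMaynardS3 GuthMaynardSmoothR GuthMaynardS3Loc
  GuthMaynardAffine GuthMaynardS3Blocks GuthMaynardS3Final GuthMaynardAssembly

/-! ## §1. Elementary inequalities -/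

/-- `K^{3/2} ≤ K^{1/2} E^{1/2}` when `K² ≤ E`, `K ≥ 0` (used with `|W|² ≤ E(W)`). [folklore] -/
private theorem rpow_three_halves_le {K E : ℝ} (hK : 0 ≤ K) (hKE : K ^ 2 ≤ E) :
    K ^ (3 / 2 : ℝ) ≤ K ^ (1 / 2 : ℝ) * E ^ (1 / 2 : ℝ) := by
  have h1 : K ^ (3 / 2 : ℝ) = K ^ (1 / 2 : ℝ) * (K ^ 2) ^ (1 / 2 : ℝ) := by
    rw [← Real.rpow_natCast K 2, ← Real.rpow_mul hK, ← Real.rpow_add' hK (by norm_num)]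
    norm_num
  rw [h1]
  gcongr

/-- `K³ ≤ 3 T^{3/2} K^{1/2} E^{1/2}` when `0 ≤ K ≤ 2T` and `K² ≤ E`. [folklore] -/
private theorem cube_le_energy {K E T : ℝ} (hK : 0 ≤ K) (hKT : K ≤ 2 * T) (hKE : K ^ 2 ≤ E) :
    K ^ 3 ≤ 3 * T ^ (3 / 2 : ℝ) * (K ^ (1 / 2 : ℝ) * E ^ (1 / 2 : ℝ)) := by
  have hT : 0 ≤ T := by linarith
  have e : K ^ 3 = K ^ (3 / 2 : ℝ) * K ^ (3 / 2 : ℝ) := by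
    rw [← Real.rpow_add_of_nonneg hK (by norm_num) (by norm_num)]; norm_num
  rw [e]
  refine mul_le_mul ?_ (rpow_three_halves_le hK hKE) (by positivity) (by positivity)
  calc K ^ (3 / 2 : ℝ) ≤ (2 * T) ^ (3 / 2 : ℝ) := Real.rpow_le_rpow hK hKT (by norm_num)
    _ = (2 : ℝ) ^ (3 / 2 : ℝ) * T ^ (3 / 2 : ℝ) := Real.mul_rpow (by norm_num) hT
    _ ≤ 3 * T ^ (3 / 2 : ℝ) := by
        refine mul_le_mul_of_nonneg_right ?_ (by positivity)
        have h : (2 : ℝ) ^ (3 / 2 : ℝ) ≤ (2 : ℝ) ^ (2 : ℝ) :=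
          Real.rpow_le_rpow_of_exponent_le (by norm_num) (by norm_num)
        have h2 : (2 : ℝ) ^ (2 : ℝ) = 4 := by norm_num
        -- `2^{3/2} = √8 < 3`
        have h3 : ((2 : ℝ) ^ (3 / 2 : ℝ)) ^ 2 = 8 := by
          rw [← Real.rpow_natCast, ← Real.rpow_mul (by norm_num)]; norm_num
        nlinarith [Real.rpow_nonneg (show (0:ℝ) ≤ 2 by norm_num) (3 / 2 : ℝ)]

/-! ## §2. The trivial bound for `S₃` (the range `N ≤ T^{1/6}`) -/

section weight

variable {w : ℝ → ℝ}

/-- **`|∑_{m ∈ ℤ} ĥ_t(Nm)| ≤ 2 sup w²`** for `N ≥ 1`: by Poisson summation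
(`GuthMaynardFourier.sum_weight_sq_cpow_eq`) the sum is `N^{-1-it} ∑_{N ≤ n ≤ 2N} w(n/N)² n^{it}`,
a sum of `N + 1` terms of size `≤ sup w²`. [cite: GuthMaynard2026, proof of Lemma 4.5] -/
theorem norm_tsum_fourier_hFun_le (hw : ContDiff ℝ ∞ w) (hsupp : Function.support w ⊆ Set.Icc 1 2)
    {Kw : ℝ} (hKw : ∀ x, (w x) ^ 2 ≤ Kw) {N : ℕ} (hN : 1 ≤ N) (t : ℝ) :
    ‖∑' m : ℤ, 𝓕 (hFun w t) ((N : ℝ) * m)‖ ≤ 2 * Kw := by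
  have hN0 : (0 : ℝ) < N := by exact_mod_cast hN
  have hNpos : 0 < N := hN
  have hKw0 : 0 ≤ Kw := le_trans (sq_nonneg _) (hKw 0)
  have hre : ((t : ℂ) * I).re = 0 := by simp [Complex.mul_re]
  have hcard : (Finset.Icc N (2 * N)).card = N + 1 := by rw [Nat.card_Icc]; omega
  have hlhs : ‖∑ n ∈ Finset.Icc N (2 * N), (((w ((n : ℝ) / N)) ^ 2 : ℝ) : ℂ) * (n : ℂ) ^ ((t : ℂ) * I)‖ ≤
      ((N : ℝ) + 1) * Kw := by
    calc ‖∑ n ∈ Finset.Icc N (2 * N), (((w ((n : ℝ) / N)) ^ 2 : ℝ) : ℂ) * (n : ℂ) ^ ((t : ℂ) * I)‖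
        ≤ ∑ n ∈ Finset.Icc N (2 * N), ‖(((w ((n : ℝ) / N)) ^ 2 : ℝ) : ℂ) * (n : ℂ) ^ ((t : ℂ) * I)‖ :=
          norm_sum_le _ _
      _ ≤ ∑ n ∈ Finset.Icc N (2 * N), Kw := by
          refine Finset.sum_le_sum fun n hn ↦ ?_
          rw [Finset.mem_Icc] at hn
          have hn0 : 0 < n := by omega
          rw [norm_mul, Complex.norm_real, Real.norm_of_nonneg (sq_nonneg _),
            Complex.norm_natCast_cpow_of_pos hn0, hre, Real.rpow_zero, mul_one]
          exact hKw _
      _ = ((N : ℝ) + 1) * Kw := by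
          rw [Finset.sum_const, nsmul_eq_mul, hcard]; push_cast; ring
  rw [sum_weight_sq_cpow_eq hw hsupp hN t, norm_mul, norm_mul, Complex.norm_natCast_cpow_of_pos hNpos,
    hre, Real.rpow_zero, one_mul, Complex.norm_natCast] at hlhs
  have hn1 : (1 : ℝ) ≤ N := by exact_mod_cast hN
  have h2 : ((N : ℝ) + 1) * Kw ≤ (N : ℝ) * (2 * Kw) := by nlinarith [mul_nonneg (sub_nonneg.mpr hn1) hKw0]
  exact le_of_mul_le_mul_left (hlhs.trans h2) hN0

/-- **`|B_N(τ)| ≪_w 1`** uniformly in `τ` and `N ≥ 1` (`B_N = ∑_m ĥ_τ(Nm) − A(τ)`,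
`GuthMaynardFourier.coefA_add_coefB`, with `|A(τ)| ≪ 1`, `GuthMaynardFourier.norm_coefA_le`).
[cite: GuthMaynard2026, Lemma 4.3 and proof of Lemma 4.5] -/
theorem norm_coefB_le_const (hw : ContDiff ℝ ∞ w) (hsupp : Function.support w ⊆ Set.Icc 1 2) :
    ∃ C, 0 ≤ C ∧ ∀ (N : ℕ), 1 ≤ N → ∀ τ : ℝ, ‖coefB w N τ‖ ≤ C := by
  obtain ⟨Kw, hKw0, hKw⟩ := exists_bound_sq hw hsupp
  obtain ⟨C_A, hC_A0, hC_A⟩ := norm_coefA_le hw hsupp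
  refine ⟨2 * Kw + C_A, by positivity, fun N hN τ ↦ ?_⟩
  have hN0 : (0 : ℝ) < N := by exact_mod_cast hN
  have h := coefA_add_coefB hw hsupp τ hN0
  have e : coefB w N τ = (∑' m : ℤ, 𝓕 (hFun w τ) ((N : ℝ) * m)) - coefA w τ := by
    rw [← h]; ring
  rw [e]
  calc ‖(∑' m : ℤ, 𝓕 (hFun w τ) ((N : ℝ) * m)) - coefA w τ‖
      ≤ ‖∑' m : ℤ, 𝓕 (hFun w τ) ((N : ℝ) * m)‖ + ‖coefA w τ‖ := norm_sub_le _ _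
    _ ≤ 2 * Kw + C_A := add_le_add (norm_tsum_fourier_hFun_le hw hsupp hKw hN τ) (hC_A τ)

/-- **The trivial bound `|S₃| ≪_w N³|W|³`** (`|B_N| ≪ 1` in each of the three factors).
[cite: GuthMaynard2026, Section 7 (definition of `S₃`)] -/
theorem norm_S3_le_trivial (hw : ContDiff ℝ ∞ w) (hsupp : Function.support w ⊆ Set.Icc 1 2) :
    ∃ C, 0 ≤ C ∧ ∀ (N : ℕ), 1 ≤ N → ∀ W : Finset ℝ,
      ‖S3 w N W‖ ≤ C * (N : ℝ) ^ 3 * (W.card : ℝ) ^ 3 := by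
  obtain ⟨C, hC0, hC⟩ := norm_coefB_le_const hw hsupp
  refine ⟨C ^ 3, by positivity, fun N hN W ↦ ?_⟩
  unfold S3
  rw [norm_mul, norm_pow, Complex.norm_natCast]
  have h := norm_triple_sum_le (W := W)
    (g := fun t₁ t₂ t₃ ↦ coefB w N (t₁ - t₂) * coefB w N (t₂ - t₃) * coefB w N (t₃ - t₁)) (K := C ^ 3)
    (fun t₁ _ t₂ _ t₃ _ ↦ by
      rw [norm_mul, norm_mul]
      calc ‖coefB w N (t₁ - t₂)‖ * ‖coefB w N (t₂ - t₃)‖ * ‖coefB w N (t₃ - t₁)‖ ≤ C * C * C := by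
            gcongr <;> exact hC N hN _
        _ = C ^ 3 := by ring)
  calc (N : ℝ) ^ 3 * ‖∑ t₁ ∈ W, ∑ t₂ ∈ W, ∑ t₃ ∈ W,
        coefB w N (t₁ - t₂) * coefB w N (t₂ - t₃) * coefB w N (t₃ - t₁)‖
      ≤ (N : ℝ) ^ 3 * ((W.card : ℝ) ^ 3 * C ^ 3) := by gcongr
    _ = C ^ 3 * (N : ℝ) ^ 3 * (W.card : ℝ) ^ 3 := by ring

end weight


/-! ## §3. Truncation of `S₃` to `∑_{m ∈ 𝓜³} I_m`, with `T` free -/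

set_option maxHeartbeats 1600000 in
/-- **Truncation cost with `T` free** (the tree's `GuthMaynardS3Final.trunc_total` is the case
`T = N^{6/5}`): for `N ≤ T ≤ N^A`, `L = N^η`, `(1+T)L ≤ NM₀ ≤ 3TL` and `ηj ≥ 1 + 6A + 6η`, replacing
`S₃` by `∑_{m ∈ 𝓜³} I_m` costs at most `A₄ T²|W|^{3/2}` (`|B_N(τ)| ≪ (1+T)²` for `|τ| ≤ T`,
`|B_N − B♭_N| ≪ (1+T)^j N^{-j} M₀^{2-j} ≪ M₀² L^{-j}`, `|W| ≤ 2T`; eq. (7.2) of the paper: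
"`S₃ = ∑_{0<|m_i| ⪅ T/N} I_m + O(T^{-100})`"). [cite: GuthMaynard2026, Section 7, (7.2)–(7.3)] -/
theorem trunc_total_freeT {w : ℝ → ℝ} (hw : ContDiff ℝ ∞ w) (hsupp : Function.support w ⊆ Set.Icc 1 2)
    {η A : ℝ} (hη0 : 0 < η) {j : ℕ} (hj2 : 2 ≤ j) (hηj : 1 + 6 * A + 6 * η ≤ η * j) :
    ∃ A₄, 0 ≤ A₄ ∧ ∀ (N : ℕ), (1 : ℝ) ≤ N → ∀ (T : ℝ), (N : ℝ) ≤ T → T ≤ (N : ℝ) ^ A →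
      ∀ (t₀ : ℝ) (W : Finset ℝ),
      (∀ t ∈ W, t₀ ≤ t ∧ t ≤ t₀ + T) →
      (W.card : ℝ) ≤ 2 * T →
      ∀ (M₀ : ℕ), 1 ≤ M₀ → (1 + T) * (N : ℝ) ^ η ≤ (N : ℝ) * M₀ →
      (N : ℝ) * M₀ ≤ 3 * T * (N : ℝ) ^ η →
      ‖S3 w N W - ∑ m ∈ Mset M₀ ×ˢ (Mset M₀ ×ˢ Mset M₀), Im w N W m‖ ≤
        A₄ * (T ^ 2 * (W.card : ℝ) ^ (3 / 2 : ℝ)) := by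
  obtain ⟨C_γ, hC_γ0, hC_γ⟩ := norm_coefB_sub_coefBflat_le hw hsupp hj2
  obtain ⟨C_β, hC_β0, hC_β⟩ := norm_coefB_le hw hsupp (le_refl 2)
  refine ⟨27 * C_γ * (4 * C_β + 9 * C_γ) ^ 2 * 4, by positivity, ?_⟩
  intro N hn1 T hNT hTA t₀ W hW hKT M₀ hM₀1 hNM₀' hNM₀
  have hn0 : (0 : ℝ) < N := by linarith
  have hnle : ∀ {x y : ℝ}, x ≤ y → (N : ℝ) ^ x ≤ (N : ℝ) ^ y := fun h ↦ Real.rpow_le_rpow_of_exponent_le hn1 h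
  have hnp : ∀ x y : ℝ, (N : ℝ) ^ x * (N : ℝ) ^ y = (N : ℝ) ^ (x + y) := fun x y ↦ (Real.rpow_add hn0 x y).symm
  set A₄ : ℝ := 27 * C_γ * (4 * C_β + 9 * C_γ) ^ 2 * 4 with hA₄
  have hT1 : 1 ≤ T := hn1.trans hNT
  have hT0 : 0 < T := by linarith
  set L : ℝ := (N : ℝ) ^ η with hL
  have hL1 : 1 ≤ L := Real.one_le_rpow hn1 hη0.le
  have hL0 : 0 < L := by linarith
  have hK0 : 0 ≤ (W.card : ℝ) := Nat.cast_nonneg _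
  have hM₀r : (1 : ℝ) ≤ M₀ := by exact_mod_cast hM₀1
  have hM₀0 : (0 : ℝ) < M₀ := by linarith
  -- the two uniform bounds `β, γ`
  set β : ℝ := C_β * (1 + T) ^ 2 with hβ
  set γ : ℝ := C_γ * (1 + T) ^ j / ((N : ℝ) ^ j * (M₀ : ℝ) ^ (j - 2)) with hγ
  have hβ0 : 0 ≤ β := by rw [hβ]; positivity
  have hγ0 : 0 ≤ γ := by rw [hγ]; positivity
  have hτ : ∀ t ∈ W, ∀ t' ∈ W, |t - t'| ≤ T := by
    intro t ht t' ht'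
    have h1 := hW t ht
    have h2 := hW t' ht'
    rw [abs_le]; constructor <;> linarith
  have hβW : ∀ t ∈ W, ∀ t' ∈ W, ‖coefB w N (t - t')‖ ≤ β := by
    intro t ht t' ht'
    refine (hC_β (t - t') N hn1).trans ?_
    rw [hβ, div_le_iff₀ (by positivity)]
    calc C_β * (1 + |t - t'|) ^ 2 ≤ C_β * (1 + T) ^ 2 := by gcongr; exact hτ t ht t' ht'
      _ = C_β * (1 + T) ^ 2 * 1 := (mul_one _).symm
      _ ≤ C_β * (1 + T) ^ 2 * (N : ℝ) ^ 2 := by gcongr; nlinarith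
  have hγW : ∀ t ∈ W, ∀ t' ∈ W, ‖coefB w N (t - t') - coefBflat w N M₀ (t - t')‖ ≤ γ := by
    intro t ht t' ht'
    refine (hC_γ (t - t') N hn1 M₀ hM₀1).trans ?_
    rw [hγ]
    gcongr
    exact hτ t ht t' ht'
  have htrunc := norm_S3_sub_sum_Im_le (w := w) N W M₀ hβ0 hγ0 hβW hγW
  -- `γ ≤ 9 C_γ T² L² N^{-2} L^{-j}`, `β + γ ≤ (4C_β + 9C_γ) T² L²`
  have hNM0 : 0 < (N : ℝ) * M₀ := by positivity
  have hq : (1 + T) / ((N : ℝ) * M₀) ≤ L⁻¹ := by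
    rw [div_le_iff₀ hNM0, inv_mul_eq_div, le_div_iff₀ hL0]
    linarith [hNM₀']
  have hγ1 : γ ≤ C_γ * (M₀ : ℝ) ^ 2 * (L ^ j)⁻¹ := by
    have hM₀j : (M₀ : ℝ) ^ j = (M₀ : ℝ) ^ (j - 2) * (M₀ : ℝ) ^ 2 := by rw [← pow_add, Nat.sub_add_cancel hj2]
    have e : (1 + T) ^ j / ((N : ℝ) ^ j * (M₀ : ℝ) ^ (j - 2)) = (M₀ : ℝ) ^ 2 * ((1 + T) / ((N : ℝ) * M₀)) ^ j := by
      rw [div_pow, mul_pow, hM₀j]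
      field_simp
    rw [hγ, mul_div_assoc, e]
    calc C_γ * ((M₀ : ℝ) ^ 2 * ((1 + T) / ((N : ℝ) * M₀)) ^ j) ≤ C_γ * ((M₀ : ℝ) ^ 2 * (L⁻¹) ^ j) := by gcongr
      _ = C_γ * (M₀ : ℝ) ^ 2 * (L ^ j)⁻¹ := by rw [inv_pow]; ring
  have hM₀sq : (M₀ : ℝ) ^ 2 * (N : ℝ) ^ 2 ≤ 9 * T ^ 2 * L ^ 2 := by
    have h := mul_le_mul hNM₀ hNM₀ (by positivity) (by positivity)
    calc (M₀ : ℝ) ^ 2 * (N : ℝ) ^ 2 = (N : ℝ) * M₀ * ((N : ℝ) * M₀) := by ring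
      _ ≤ 3 * T * L * (3 * T * L) := h
      _ = 9 * T ^ 2 * L ^ 2 := by ring
  have hLj : (L ^ j)⁻¹ = (N : ℝ) ^ (-(η * j)) := by
    rw [hL, ← Real.rpow_natCast, ← Real.rpow_mul hn0.le, Real.rpow_neg hn0.le]
  have hγ2 : γ ≤ 9 * C_γ * T ^ 2 * L ^ 2 / (N : ℝ) ^ 2 * (L ^ j)⁻¹ := by
    refine hγ1.trans ?_
    have : (M₀ : ℝ) ^ 2 ≤ 9 * T ^ 2 * L ^ 2 / (N : ℝ) ^ 2 := by rw [le_div_iff₀ (by positivity)]; exact hM₀sq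
    calc C_γ * (M₀ : ℝ) ^ 2 * (L ^ j)⁻¹ ≤ C_γ * (9 * T ^ 2 * L ^ 2 / (N : ℝ) ^ 2) * (L ^ j)⁻¹ := by gcongr
      _ = _ := by ring
  have hγ3 : γ ≤ 9 * C_γ * T ^ 2 * L ^ 2 := by
    refine hγ1.trans ?_
    have h1 : (L ^ j)⁻¹ ≤ 1 := inv_le_one_of_one_le₀ (one_le_pow₀ hL1)
    have h2 : (M₀ : ℝ) ^ 2 ≤ 9 * T ^ 2 * L ^ 2 := by
      have : (M₀ : ℝ) ^ 2 ≤ (M₀ : ℝ) ^ 2 * (N : ℝ) ^ 2 := le_mul_of_one_le_right (by positivity) (by nlinarith)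
      linarith
    calc C_γ * (M₀ : ℝ) ^ 2 * (L ^ j)⁻¹ ≤ C_γ * (9 * T ^ 2 * L ^ 2) * 1 := by gcongr
      _ = _ := by ring
  have hβ3 : β ≤ 4 * C_β * T ^ 2 * L ^ 2 := by
    have : (1 + T) ^ 2 ≤ 4 * T ^ 2 * L ^ 2 := by
      have h1 : (1 + T) ^ 2 ≤ 4 * T ^ 2 := by nlinarith
      have h2 : 4 * T ^ 2 ≤ 4 * T ^ 2 * L ^ 2 := le_mul_of_one_le_right (by positivity) (by nlinarith)
      linarith
    calc β = C_β * (1 + T) ^ 2 := rfl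
      _ ≤ C_β * (4 * T ^ 2 * L ^ 2) := by gcongr
      _ = _ := by ring
  have hβγ : β + γ ≤ (4 * C_β + 9 * C_γ) * T ^ 2 * L ^ 2 := by linarith
  have hK3 : (W.card : ℝ) ^ 3 ≤ 4 * T ^ 2 * (W.card : ℝ) ^ (3 / 2 : ℝ) := cube_le hK0 hT1 hKT
  have hpow1 : (N : ℝ) * T ^ 6 * L ^ 6 * (L ^ j)⁻¹ ≤ 1 := by
    rw [hLj]
    have hT6 : T ^ 6 ≤ (N : ℝ) ^ (6 * A) := by
      calc T ^ 6 ≤ ((N : ℝ) ^ A) ^ 6 := pow_le_pow_left₀ hT0.le hTA 6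
        _ = (N : ℝ) ^ (6 * A) := by
            rw [← Real.rpow_natCast, ← Real.rpow_mul hn0.le]; congr 1; push_cast; ring
    have eL : L ^ 6 = (N : ℝ) ^ (η * 6) := by rw [hL, ← Real.rpow_natCast, ← Real.rpow_mul hn0.le]; norm_num
    calc (N : ℝ) * T ^ 6 * L ^ 6 * (N : ℝ) ^ (-(η * j))
        ≤ (N : ℝ) * (N : ℝ) ^ (6 * A) * L ^ 6 * (N : ℝ) ^ (-(η * j)) := by gcongr
      _ = (N : ℝ) ^ (1 : ℝ) * (N : ℝ) ^ (6 * A) * (N : ℝ) ^ (η * 6) * (N : ℝ) ^ (-(η * j)) := by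
          rw [Real.rpow_one, eL]
      _ = (N : ℝ) ^ (1 + 6 * A + η * 6 + -(η * j)) := by rw [hnp, hnp, hnp]
      _ ≤ (N : ℝ) ^ (0 : ℝ) := hnle (by linarith)
      _ = 1 := Real.rpow_zero _
  have htrunc_le : (N : ℝ) ^ 3 * (W.card : ℝ) ^ 3 * (3 * γ * (β + γ) ^ 2) ≤
      A₄ * (T ^ 2 * (W.card : ℝ) ^ (3 / 2 : ℝ)) := by
    calc (N : ℝ) ^ 3 * (W.card : ℝ) ^ 3 * (3 * γ * (β + γ) ^ 2)
        ≤ (N : ℝ) ^ 3 * (4 * T ^ 2 * (W.card : ℝ) ^ (3 / 2 : ℝ)) *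
            (3 * (9 * C_γ * T ^ 2 * L ^ 2 / (N : ℝ) ^ 2 * (L ^ j)⁻¹) * ((4 * C_β + 9 * C_γ) * T ^ 2 * L ^ 2) ^ 2) := by
          gcongr
      _ = A₄ * (T ^ 2 * (W.card : ℝ) ^ (3 / 2 : ℝ)) * ((N : ℝ) * T ^ 6 * L ^ 6 * (L ^ j)⁻¹) := by
          simp only [hA₄]; field_simp; ring
      _ ≤ A₄ * (T ^ 2 * (W.card : ℝ) ^ (3 / 2 : ℝ)) * 1 := by gcongr
      _ = _ := mul_one _
  exact htrunc.trans htrunc_le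


/-! ## §4. The arithmetic of one block -/

set_option maxHeartbeats 400000 in
/-- **The simple-block inequality** (pure real arithmetic). [cite: GuthMaynard2026, proof of Proposition 8.1] -/
theorem simple_block_alg {K E T N L Mx G1 G2 J₁ J₂ C_b C₂ C₄ P₁ ρ c₀ : ℝ}
    (hK : 0 ≤ K) (hKT : K ≤ 2 * T) (hE : 0 ≤ E) (hKE : K ^ 2 ≤ E) (hT : 1 ≤ T) (hN : 1 ≤ N)
    (hL : 1 ≤ L) (hMx : 1 ≤ Mx) (hNMx : N * Mx ≤ 3 * T * L)
    (hG1 : 0 ≤ G1) (hG1K : G1 ≤ C₂ * K) (hG2 : 0 ≤ G2) (hρ0 : 0 ≤ ρ) (hρ : ρ * T ^ 2 ≤ 1)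
    (hG2E : G2 ≤ C₄ * L * E + C₄ * ρ * K ^ 4)
    (hC_b : 0 ≤ C_b) (hC₂ : 1 ≤ C₂) (hC₄ : 1 ≤ C₄) (hP₁ : 1 ≤ P₁) (hc₀ : 1 ≤ c₀)
    (hJ₁ : 0 ≤ J₁) (hJ₂ : 0 ≤ J₂)
    (hJ₁b : J₁ ≤ c₀ * Mx ^ 6 * (P₁ ^ 2 * G2)) (hJ₂b : J₂ ≤ c₀ * Mx ^ 6 * (P₁ ^ 2 * G2)) :
    C_b * (N ^ 2 * L / Mx) * (G1 ^ (1 / 2 : ℝ) * (4 * J₁) ^ (1 / 4 : ℝ) * J₂ ^ (1 / 4 : ℝ)) ≤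
      (54 * c₀ * C_b * C₂ * C₄ * P₁) * L ^ 4 * (T ^ 2 * K ^ (1 / 2 : ℝ) * E ^ (1 / 2 : ℝ)) := by
  have hT0 : 0 < T := by linarith
  have hN0 : 0 < N := by linarith
  have hMx0 : 0 < Mx := by linarith
  have hL0 : 0 < L := by linarith
  have hC₂0 : 0 ≤ C₂ := by linarith
  have hC₄0 : 0 ≤ C₄ := by linarith
  have hP₁0 : 0 ≤ P₁ := by linarith
  have hc₀0 : 0 ≤ c₀ := by linarith
  set Y : ℝ := c₀ * Mx ^ 6 * (P₁ ^ 2 * G2) with hY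
  have hY0 : 0 ≤ Y := by rw [hY]; positivity
  set k₁ : ℝ := K ^ (1 / 2 : ℝ) with hk₁
  set e : ℝ := E ^ (1 / 2 : ℝ) with he
  set r : ℝ := ρ ^ (1 / 2 : ℝ) with hr
  have hk₁0 : 0 ≤ k₁ := by rw [hk₁]; positivity
  have he0 : 0 ≤ e := by rw [he]; positivity
  have hr0 : 0 ≤ r := by rw [hr]; positivity
  -- Step 1: `(4J₁)^{1/4} J₂^{1/4} ≤ 2 Y^{1/2}`
  have h1 : (4 * J₁) ^ (1 / 4 : ℝ) * J₂ ^ (1 / 4 : ℝ) ≤ 2 * Y ^ (1 / 2 : ℝ) := quarter_powers_le hJ₁ hJ₂ hJ₁b hJ₂b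
  -- Step 2: `Y^{1/2} ≤ c₀ Mx³ P₁ G2^{1/2}`
  have h2 : Y ^ (1 / 2 : ℝ) ≤ c₀ * (Mx ^ 3 * P₁) * G2 ^ (1 / 2 : ℝ) := by
    have eY : Y = c₀ * (Mx ^ 3 * P₁) ^ 2 * G2 := by rw [hY]; ring
    rw [eY, Real.mul_rpow (by positivity) hG2, Real.mul_rpow hc₀0 (by positivity), sq_rpow_half (by positivity)]
    gcongr
    exact rpow_half_le_self hc₀
  -- Step 3: `G2^{1/2} ≤ 3 C₄ L E^{1/2}` (uses `K² ≤ E`, `K ≤ 2T`, `ρ T² ≤ 1`)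
  have hKe : K ≤ e := by
    have : (K ^ 2) ^ (1 / 2 : ℝ) ≤ E ^ (1 / 2 : ℝ) := Real.rpow_le_rpow (sq_nonneg _) hKE (by norm_num)
    rwa [sq_rpow_half hK] at this
  have hrT : r * T ≤ 1 := by
    have : (ρ * T ^ 2) ^ (1 / 2 : ℝ) ≤ 1 := by
      calc (ρ * T ^ 2) ^ (1 / 2 : ℝ) ≤ (1 : ℝ) ^ (1 / 2 : ℝ) := Real.rpow_le_rpow (by positivity) hρ (by norm_num)
        _ = 1 := Real.one_rpow _
    rwa [Real.mul_rpow hρ0 (by positivity), sq_rpow_half hT0.le] at this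
  have h3 : G2 ^ (1 / 2 : ℝ) ≤ 3 * C₄ * L * e := by
    have s₄le : C₄ ^ (1 / 2 : ℝ) ≤ C₄ := rpow_half_le_self hC₄
    have hL12 : L ^ (1 / 2 : ℝ) ≤ L := rpow_half_le_self hL
    have hs₄0 : 0 ≤ C₄ ^ (1 / 2 : ℝ) := by positivity
    have hrK : r * K ^ 2 ≤ 2 * e := by
      calc r * K ^ 2 = (r * K) * K := by ring
        _ ≤ (r * (2 * T)) * e := by gcongr
        _ = 2 * (r * T) * e := by ring
        _ ≤ 2 * 1 * e := by gcongr
        _ = 2 * e := by ring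
    calc G2 ^ (1 / 2 : ℝ) ≤ (C₄ * L * E + C₄ * ρ * K ^ 4) ^ (1 / 2 : ℝ) := Real.rpow_le_rpow hG2 hG2E (by norm_num)
      _ ≤ (C₄ * L * E) ^ (1 / 2 : ℝ) + (C₄ * ρ * K ^ 4) ^ (1 / 2 : ℝ) := rpow_half_add_le (by positivity) (by positivity)
      _ = C₄ ^ (1 / 2 : ℝ) * L ^ (1 / 2 : ℝ) * e + C₄ ^ (1 / 2 : ℝ) * (r * K ^ 2) := by
          rw [Real.mul_rpow (by positivity) hE, Real.mul_rpow hC₄0 hL0.le,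
            Real.mul_rpow (by positivity) (by positivity), Real.mul_rpow hC₄0 hρ0,
            show K ^ 4 = (K ^ 2) ^ 2 by ring, sq_rpow_half (by positivity)]
          ring
      _ ≤ C₄ * L * e + C₄ * (2 * e) := by gcongr
      _ ≤ 3 * C₄ * L * e := by nlinarith [mul_nonneg hC₄0 he0, hL]
  -- Step 4: `G1^{1/2} ≤ C₂ K^{1/2}`
  have h4 : G1 ^ (1 / 2 : ℝ) ≤ C₂ * k₁ := by
    calc G1 ^ (1 / 2 : ℝ) ≤ (C₂ * K) ^ (1 / 2 : ℝ) := Real.rpow_le_rpow hG1 hG1K (by norm_num)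
      _ = C₂ ^ (1 / 2 : ℝ) * k₁ := by rw [Real.mul_rpow hC₂0 hK]
      _ ≤ C₂ * k₁ := by gcongr; exact rpow_half_le_self hC₂
  -- Step 5: combine, `N² Mx² ≤ 9 T² L²`
  have h5 : G1 ^ (1 / 2 : ℝ) * (4 * J₁) ^ (1 / 4 : ℝ) * J₂ ^ (1 / 4 : ℝ) ≤
      (C₂ * k₁) * (2 * (c₀ * (Mx ^ 3 * P₁) * (3 * C₄ * L * e))) := by
    rw [mul_assoc]
    refine mul_le_mul h4 ?_ (by positivity) (by positivity)
    refine h1.trans ?_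
    refine mul_le_mul_of_nonneg_left (h2.trans ?_) (by norm_num)
    exact mul_le_mul_of_nonneg_left h3 (by positivity)
  have hNM2 : N ^ 2 * Mx ^ 2 ≤ 9 * T ^ 2 * L ^ 2 := by
    have h := mul_le_mul hNMx hNMx (by positivity) (by positivity)
    nlinarith [h]
  calc C_b * (N ^ 2 * L / Mx) * (G1 ^ (1 / 2 : ℝ) * (4 * J₁) ^ (1 / 4 : ℝ) * J₂ ^ (1 / 4 : ℝ))
      ≤ C_b * (N ^ 2 * L / Mx) * ((C₂ * k₁) * (2 * (c₀ * (Mx ^ 3 * P₁) * (3 * C₄ * L * e)))) :=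
        mul_le_mul_of_nonneg_left h5 (by positivity)
    _ = 6 * c₀ * C_b * C₂ * C₄ * P₁ * (N ^ 2 * Mx ^ 2) * L ^ 2 * (k₁ * e) := by
        field_simp
        ring
    _ ≤ 6 * c₀ * C_b * C₂ * C₄ * P₁ * (9 * T ^ 2 * L ^ 2) * L ^ 2 * (k₁ * e) := by gcongr
    _ = (54 * c₀ * C_b * C₂ * C₄ * P₁) * L ^ 4 * (T ^ 2 * k₁ * e) := by ring


/-! ## §5. One block (Proposition 7.2 + Hölder + change of variables + Lemmas 8.2–8.3) -/

set_option maxHeartbeats 1600000 in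
/-- **One block, simple version, `T` free** (no Proposition 9.1): for a block `shell ia × shell ib × shell i₃`
(or its swap), `ia ≤ ib`, `i₃ ≤ ib + 4`, localised at the scale `B = N2^{ib}N^{-η}` (`N ≤ T ≤ N^A`, `NM₀ ≤ 3TN^η`, `η(j−1) ≥ 2A`), the analytic bound of
`GuthMaynardS3Blocks.block_sum_le_*` is at most `A₁ N^{4η} T²|W|^{1/2}E(W)^{1/2}` once the TRIVIAL bound for
`J(f_B)` (`GuthMaynardAffine.Jfun_trivial`: Cauchy–Schwarz and the change of variables
`u = (m₁v + m₃)/m₂`, Jacobian `≍ M/M₁`) and Lemmas 8.2–8.3 (`∫ g_W ≪ |W|`, `∫ f_B² ≪ ∫ g_W² ≪ N^η E(W)`)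
are inserted — the printed proof of Proposition 8.1 ("Using Hölder's inequality … change of variables …
Using `M ⪅ T/N` and Lemmas 8.2 and 8.3"). [cite: GuthMaynard2026, proof of Proposition 8.1] -/
theorem simple_block {η A C₂ C₄ C_b : ℝ} {j : ℕ} (hη0 : 0 < η)
    (hC₂1 : 1 ≤ C₂) (hC₄1 : 1 ≤ C₄) (hηj : 2 * A ≤ η * ((j : ℝ) - 1))
    (hC₄ : ∀ (W : Finset ℝ) (D : ℝ), 1 ≤ D →
      ∫ u, gW W u ^ 2 ≤ C₄ * D * addEnergy W + C₄ * D / D ^ j * (W.card : ℝ) ^ 4)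
    (hC_b0 : 0 ≤ C_b)
    {N : ℕ} (hN : (1 : ℝ) ≤ N) {T : ℝ} (hNT : (N : ℝ) ≤ T) (hTA : T ≤ (N : ℝ) ^ A)
    (W : Finset ℝ) (hC₂W : ∫ u, gW W u ≤ C₂ * W.card) (hKT : (W.card : ℝ) ≤ 2 * T)
    {M₀ : ℕ} (hNM₀ : (N : ℝ) * M₀ ≤ 3 * T * (N : ℝ) ^ η)
    {ia ib i₃ : ℕ} (hia : ia ≤ ib) (hi₃ : i₃ ≤ ib + 4) (hib : (2 : ℝ) ^ ib ≤ M₀) :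
    C_b * ((N : ℝ) ^ 3 / ((N : ℝ) * 2 ^ ib / (N : ℝ) ^ η)) *
        ((∫ u, gW W u) ^ (1 / 2 : ℝ) *
          (4 * Jfun (fB W ((N : ℝ) * 2 ^ ib / (N : ℝ) ^ η)) (shell M₀ i₃) (shell M₀ ib) (2 ^ (ia + 1))) ^ (1 / 4 : ℝ) *
          (Jfun (fB W ((N : ℝ) * 2 ^ ib / (N : ℝ) ^ η)) (shell M₀ ia) (shell M₀ ib) (2 ^ (i₃ + 1))) ^ (1 / 4 : ℝ)) ≤
      (54 * 11000000 * C_b * C₂ * C₄ * (max (∫ x, psi1 x) 1)) * ((N : ℝ) ^ η) ^ 4 *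
        (T ^ 2 * (W.card : ℝ) ^ (1 / 2 : ℝ) * (addEnergy W) ^ (1 / 2 : ℝ)) := by
  -- basic quantities
  have hn1 : (1 : ℝ) ≤ N := hN
  have hn0 : (0 : ℝ) < N := by linarith
  have hnle : ∀ {x y : ℝ}, x ≤ y → (N : ℝ) ^ x ≤ (N : ℝ) ^ y := fun h ↦ Real.rpow_le_rpow_of_exponent_le hn1 h
  have hnp : ∀ x y : ℝ, (N : ℝ) ^ x * (N : ℝ) ^ y = (N : ℝ) ^ (x + y) := fun x y ↦ (Real.rpow_add hn0 x y).symm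
  have hT1 : 1 ≤ T := hn1.trans hNT
  have hT0 : 0 < T := by linarith
  set L : ℝ := (N : ℝ) ^ η with hL
  have hL1 : 1 ≤ L := Real.one_le_rpow hn1 hη0.le
  have hL0 : 0 < L := by linarith
  set K : ℝ := (W.card : ℝ) with hK
  have hK0 : 0 ≤ K := Nat.cast_nonneg _
  set E : ℝ := addEnergy W with hE
  have hE0 : 0 ≤ E := addEnergy_nonneg W
  have hKE : K ^ 2 ≤ E := GuthMaynardEnergyBound.card_sq_le_energy W
  set P₁ : ℝ := ∫ x, psi1 x with hP₁
  have hP₁0 : 0 < P₁ := integral_psi1_pos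
  set P₁' : ℝ := max P₁ 1 with hP₁'
  have hP₁'1 : 1 ≤ P₁' := le_max_right _ _
  have hP₁le : P₁ ≤ P₁' := le_max_left _ _
  set Mx : ℝ := (2 : ℝ) ^ ib with hMx
  have hMx1 : 1 ≤ Mx := one_le_pow₀ (by norm_num)
  have hMx0 : 0 < Mx := by linarith
  set B : ℝ := (N : ℝ) * Mx / L with hB
  have hB0 : 0 < B := by rw [hB]; positivity
  have hNMx : (N : ℝ) * Mx ≤ 3 * T * L := (mul_le_mul_of_nonneg_left hib hn0.le).trans hNM₀
  -- the function `f_B`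
  set f : ℝ → ℝ := fB W B with hf
  have hfc : ContDiff ℝ ∞ f := fB_contDiff W hB0
  have hfs : HasCompactSupport f := hasCompactSupport_fB W hB0
  -- moments (Lemmas 8.2 and 8.3)
  set G1 : ℝ := ∫ u, gW W u with hG1
  set G2 : ℝ := ∫ u, gW W u ^ 2 with hG2
  have hG10 : 0 ≤ G1 := integral_nonneg (gW_nonneg W)
  have hG20 : 0 ≤ G2 := integral_nonneg fun u ↦ sq_nonneg _
  have hf2 : ∫ y, f y ^ 2 ≤ P₁ ^ 2 * G2 := integral_fB_sq_le W hB0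
  have hf2' : ∫ y, f y ^ 2 ≤ P₁' ^ 2 * G2 := hf2.trans (by gcongr)
  set ρ : ℝ := L / L ^ j with hρ
  have hρ0 : 0 ≤ ρ := by rw [hρ]; positivity
  have hG2E : G2 ≤ C₄ * L * E + C₄ * ρ * K ^ 4 := by
    have := hC₄ W L hL1
    simp only [hρ]
    calc G2 ≤ C₄ * L * E + C₄ * L / L ^ j * K ^ 4 := this
      _ = C₄ * L * E + C₄ * (L / L ^ j) * K ^ 4 := by ring
  have hρT : ρ * T ^ 2 ≤ 1 := by
    have e1 : ρ = (N : ℝ) ^ (η - η * j) := by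
      rw [hρ, hL, ← Real.rpow_natCast, ← Real.rpow_mul hn0.le, ← Real.rpow_sub hn0]
    have hT2 : T ^ 2 ≤ (N : ℝ) ^ (2 * A) := by
      calc T ^ 2 ≤ ((N : ℝ) ^ A) ^ 2 := pow_le_pow_left₀ hT0.le hTA 2
        _ = (N : ℝ) ^ (2 * A) := by
            rw [← Real.rpow_natCast, ← Real.rpow_mul hn0.le]; congr 1; push_cast; ring
    calc ρ * T ^ 2 ≤ (N : ℝ) ^ (η - η * j) * (N : ℝ) ^ (2 * A) := by rw [e1]; gcongr
      _ = (N : ℝ) ^ (η - η * j + 2 * A) := hnp _ _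
      _ ≤ (N : ℝ) ^ (0 : ℝ) := hnle (by linarith)
      _ = 1 := Real.rpow_zero _
  -- shells
  have hshell : ∀ i : ℕ, ∀ m ∈ shell M₀ i, (2 : ℝ) ^ i ≤ |(m : ℝ)| ∧ |(m : ℝ)| ≤ 2 * 2 ^ i :=
    fun i m hm ↦ shell_bounds hm
  have hone : ∀ i : ℕ, (1 : ℝ) ≤ 2 ^ i := fun i ↦ one_le_pow₀ (by norm_num)
  have hpow_le : ∀ {a b : ℕ}, a ≤ b → (2 : ℝ) ^ a ≤ 2 ^ b := fun h ↦ pow_le_pow_right₀ (by norm_num) h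
  have hcard : ∀ i : ℕ, ((shell M₀ i).card : ℝ) ≤ 6 * 2 ^ i := fun i ↦
    GuthMaynardAffine.card_shell_le (hone i) (hshell i)
  have hia_M : (2 : ℝ) ^ ia ≤ Mx := hpow_le hia
  have hi₃_M : (2 : ℝ) ^ i₃ ≤ 16 * Mx := by
    calc (2 : ℝ) ^ i₃ ≤ 2 ^ (ib + 4) := hpow_le hi₃
      _ = 16 * Mx := by rw [pow_add]; ring
  -- the two trivial `J` bounds (Cauchy–Schwarz + change of variables)
  have hJ₂ := Jfun_trivial hfc hfs (hone ia) (hone ib) (hshell ia) (hshell ib) (2 ^ (i₃ + 1))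
  have hJ₁ := Jfun_trivial hfc hfs (hone i₃) (hone ib) (hshell i₃) (hshell ib) (2 ^ (ia + 1))
  set c₀ : ℝ := 11000000 with hc₀
  have hc₀1 : (1 : ℝ) ≤ c₀ := by norm_num [hc₀]
  have hf20 : 0 ≤ ∫ y, f y ^ 2 := integral_nonneg fun y ↦ sq_nonneg _
  have hcb : ((shell M₀ ib).card : ℝ) ^ 2 ≤ 36 * Mx ^ 2 := by
    calc ((shell M₀ ib).card : ℝ) ^ 2 ≤ (6 * 2 ^ ib) ^ 2 := by gcongr; exact hcard ib
      _ = 36 * Mx ^ 2 := by rw [hMx]; ring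
  have hJ₂b : Jfun f (shell M₀ ia) (shell M₀ ib) (2 ^ (i₃ + 1)) ≤ c₀ * Mx ^ 6 * (P₁' ^ 2 * G2) := by
    refine hJ₂.trans ?_
    have hA : ((shell M₀ ia).card : ℝ) ^ 2 * (2 * 2 ^ ib / 2 ^ ia) ≤ 72 * Mx ^ 2 := by
      have h2ia : (0 : ℝ) < 2 ^ ia := by positivity
      calc ((shell M₀ ia).card : ℝ) ^ 2 * (2 * 2 ^ ib / 2 ^ ia) ≤ (6 * 2 ^ ia) ^ 2 * (2 * 2 ^ ib / 2 ^ ia) := by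
            gcongr; exact hcard ia
        _ = 72 * 2 ^ ia * Mx := by rw [hMx]; field_simp; ring
        _ ≤ 72 * Mx * Mx := by gcongr
        _ = 72 * Mx ^ 2 := by ring
    have hC : (2 * (((2 ^ (i₃ + 1) : ℕ)) : ℝ) + 1) ^ 2 ≤ (65 * Mx) ^ 2 := by
      gcongr
      push_cast
      rw [pow_succ]
      linarith
    calc ((shell M₀ ia).card : ℝ) ^ 2 * ((shell M₀ ib).card : ℝ) ^ 2 * (2 * (((2 ^ (i₃ + 1) : ℕ)) : ℝ) + 1) ^ 2 *
          (2 * 2 ^ ib / 2 ^ ia) * ∫ y, f y ^ 2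
        = (((shell M₀ ia).card : ℝ) ^ 2 * (2 * 2 ^ ib / 2 ^ ia)) * ((shell M₀ ib).card : ℝ) ^ 2 *
            (2 * (((2 ^ (i₃ + 1) : ℕ)) : ℝ) + 1) ^ 2 * ∫ y, f y ^ 2 := by ring
      _ ≤ (72 * Mx ^ 2) * (36 * Mx ^ 2) * (65 * Mx) ^ 2 * (P₁' ^ 2 * G2) := by gcongr
      _ = 10951200 * Mx ^ 6 * (P₁' ^ 2 * G2) := by ring
      _ ≤ c₀ * Mx ^ 6 * (P₁' ^ 2 * G2) := by gcongr; norm_num [hc₀]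
  have hJ₁b : Jfun f (shell M₀ i₃) (shell M₀ ib) (2 ^ (ia + 1)) ≤ c₀ * Mx ^ 6 * (P₁' ^ 2 * G2) := by
    refine hJ₁.trans ?_
    have hA : ((shell M₀ i₃).card : ℝ) ^ 2 * (2 * 2 ^ ib / 2 ^ i₃) ≤ 1152 * Mx ^ 2 := by
      have h2i : (0 : ℝ) < 2 ^ i₃ := by positivity
      calc ((shell M₀ i₃).card : ℝ) ^ 2 * (2 * 2 ^ ib / 2 ^ i₃) ≤ (6 * 2 ^ i₃) ^ 2 * (2 * 2 ^ ib / 2 ^ i₃) := by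
            gcongr; exact hcard i₃
        _ = 72 * 2 ^ i₃ * Mx := by rw [hMx]; field_simp; ring
        _ ≤ 72 * (16 * Mx) * Mx := by gcongr
        _ = 1152 * Mx ^ 2 := by ring
    have hC : (2 * (((2 ^ (ia + 1) : ℕ)) : ℝ) + 1) ^ 2 ≤ (5 * Mx) ^ 2 := by
      gcongr
      push_cast
      rw [pow_succ]
      linarith
    calc ((shell M₀ i₃).card : ℝ) ^ 2 * ((shell M₀ ib).card : ℝ) ^ 2 * (2 * (((2 ^ (ia + 1) : ℕ)) : ℝ) + 1) ^ 2 *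
          (2 * 2 ^ ib / 2 ^ i₃) * ∫ y, f y ^ 2
        = (((shell M₀ i₃).card : ℝ) ^ 2 * (2 * 2 ^ ib / 2 ^ i₃)) * ((shell M₀ ib).card : ℝ) ^ 2 *
            (2 * (((2 ^ (ia + 1) : ℕ)) : ℝ) + 1) ^ 2 * ∫ y, f y ^ 2 := by ring
      _ ≤ (1152 * Mx ^ 2) * (36 * Mx ^ 2) * (5 * Mx) ^ 2 * (P₁' ^ 2 * G2) := by gcongr
      _ = 1036800 * Mx ^ 6 * (P₁' ^ 2 * G2) := by ring
      _ ≤ c₀ * Mx ^ 6 * (P₁' ^ 2 * G2) := by gcongr; norm_num [hc₀]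
  have hJ₁0 : 0 ≤ Jfun f (shell M₀ i₃) (shell M₀ ib) (2 ^ (ia + 1)) := integral_nonneg fun u ↦ sq_nonneg _
  have hJ₂0 : 0 ≤ Jfun f (shell M₀ ia) (shell M₀ ib) (2 ^ (i₃ + 1)) := integral_nonneg fun u ↦ sq_nonneg _
  -- `N³/B = N²L/Mx`
  have hNB : (N : ℝ) ^ 3 / B = (N : ℝ) ^ 2 * L / Mx := by
    rw [hB]
    field_simp
  rw [hNB]
  exact simple_block_alg (C_b := C_b) hK0 hKT hE0 hKE hT1 hn1 hL1 hMx1 hNMx hG10 hC₂W hG20 hρ0 hρT hG2E hC_b0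
    hC₂1 hC₄1 hP₁'1 hc₀1 hJ₁0 hJ₂0 hJ₁b hJ₂b


/-! ## §6. One dyadic block -/

set_option maxHeartbeats 3200000 in
/-- **One dyadic block, simple version, `T` free**: for a block `shell i₁ × shell i₂ × shell i₃` of `𝓜³`
with `2^{i₁}, 2^{i₂} ≤ M₀` (`N ≤ T ≤ N^A`, `NM₀ ≤ 3TN^η`, `η(j−1) ≥ 2A`, `W ⊂ [t₀, t₀+T]` `1`-separated), either
`i₃ ≥ max(i₁,i₂) + 5` and every `|I_m|` is negligible (`|θ| ≥ N` on the box,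
`GuthMaynardS3Blocks.majorant_le_of_far_block`), or the block is localised in the larger of `|m₁|, |m₂|`
(Proposition 7.2, `GuthMaynardS3Blocks.block_sum_le_snd/fst`) and bounded by `simple_block`:
`∑_{m ∈ block} |I_m| ≤ A₁ N^{4η} T²|W|^{1/2}E(W)^{1/2} + |block| · C_n N³|W|³N^{-ηj}`.
[cite: GuthMaynard2026, proof of Proposition 8.1 (with the dyadic decomposition of Proposition 7.2)] -/
theorem simple_block_bound {w : ℝ → ℝ} (hw : ContDiff ℝ ∞ w) (hsupp : Function.support w ⊆ Set.Icc 1 2)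
    {η A : ℝ} (hη0 : 0 < η) (hη1 : η ≤ 1) (j : ℕ) (hηj : 2 * A ≤ η * ((j : ℝ) - 1)) :
    ∃ A₁ Cn : ℝ, 0 ≤ A₁ ∧ 0 ≤ Cn ∧ ∀ (N : ℕ), (1 : ℝ) ≤ (N : ℝ) → ∀ (T : ℝ), (N : ℝ) ≤ T → T ≤ (N : ℝ) ^ A →
      ∀ (t₀ : ℝ) (W : Finset ℝ),
      (∀ t ∈ W, t₀ ≤ t ∧ t ≤ t₀ + T) →
      (∀ t ∈ W, ∀ t' ∈ W, t ≠ t' → 1 ≤ |t - t'|) →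
      ∀ (M₀ : ℕ), (N : ℝ) * M₀ ≤ 3 * T * (N : ℝ) ^ η →
      ∀ (i₁ i₂ i₃ : ℕ), (2 : ℝ) ^ i₁ ≤ M₀ → (2 : ℝ) ^ i₂ ≤ M₀ →
      ∑ m ∈ shell M₀ i₁ ×ˢ (shell M₀ i₂ ×ˢ shell M₀ i₃), ‖Im w N W m‖ ≤
        A₁ * ((N : ℝ) ^ η) ^ 4 *
          (T ^ 2 * (W.card : ℝ) ^ (1 / 2 : ℝ) * (addEnergy W) ^ (1 / 2 : ℝ)) +
        ((shell M₀ i₁ ×ˢ (shell M₀ i₂ ×ˢ shell M₀ i₃)).card : ℝ) *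
          (Cn * ((N : ℝ) ^ 3 * (W.card : ℝ) ^ 3 * (N : ℝ) ^ (-(η * j)))) := by
  set P₁ : ℝ := ∫ x, psi1 x
  have hP₁0 : 0 < P₁ := integral_psi1_pos
  -- constants
  obtain ⟨C_b, hC_b0, hC_b⟩ := block_sum_le_snd hw hsupp hη0 j
  obtain ⟨C_b', -, hC_b'⟩ := block_sum_le_fst hw hsupp hη0 j
  obtain ⟨D, hD0, hD⟩ := norm_Im_le_majorant hw hsupp j
  obtain ⟨C₂, -, hC₂⟩ := integral_gW_le_card
  obtain ⟨C₄, -, hC₄⟩ := integral_gW_sq_le_energy j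
  -- constants made `≥ 1`
  obtain ⟨C₂', hC₂'⟩ : ∃ C : ℝ, C = max C₂ 1 := ⟨_, rfl⟩
  obtain ⟨C₄', hC₄'⟩ : ∃ C : ℝ, C = max C₄ 1 := ⟨_, rfl⟩
  have hC₂'1 : 1 ≤ C₂' := by rw [hC₂']; exact le_max_right _ _
  have hC₄'1 : 1 ≤ C₄' := by rw [hC₄']; exact le_max_right _ _
  have hC₂le : C₂ ≤ C₂' := by rw [hC₂']; exact le_max_left _ _
  have hC₄le : C₄ ≤ C₄' := by rw [hC₄']; exact le_max_left _ _
  obtain ⟨Cmb, hCmb⟩ : ∃ C : ℝ, C = max C_b C_b' := ⟨_, rfl⟩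
  have hCb_le : C_b ≤ Cmb := by rw [hCmb]; exact le_max_left _ _
  have hCb'_le : C_b' ≤ Cmb := by rw [hCmb]; exact le_max_right _ _
  have hCmb0 : 0 ≤ Cmb := hC_b0.trans hCb_le
  set A₁ : ℝ := 54 * 11000000 * Cmb * C₂' * C₄' * (max P₁ 1) with hA₁
  have hA₁0 : 0 ≤ A₁ := by rw [hA₁]; positivity
  refine ⟨A₁, 9 / 4 * D + Cmb, hA₁0, by positivity, ?_⟩
  intro N hN T hNT hTA t₀ W hW hsep1 M₀ hNM₀ i₁ i₂ i₃ hi₁ hi₂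
  have hn1 : (1 : ℝ) ≤ N := hN
  have hn0 : (0 : ℝ) < N := by linarith
  have hNnat : 1 ≤ N := by exact_mod_cast hn1
  have hT1 : 1 ≤ T := hn1.trans hNT
  have hKT : (W.card : ℝ) ≤ 2 * T := by
    have h := SeparatedSums.card_le_of_sep one_pos (by linarith) W hW hsep1
    rw [div_one] at h
    linarith
  have hLN : (N : ℝ) ^ η ≤ N := by
    calc (N : ℝ) ^ η ≤ (N : ℝ) ^ (1 : ℝ) := Real.rpow_le_rpow_of_exponent_le hn1 hη1
      _ = N := Real.rpow_one _
  -- the constants' defining properties, with the enlarged constants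
  have hC₂'' : ∫ u, gW W u ≤ C₂' * W.card :=
    (hC₂ W hsep1).trans (mul_le_mul_of_nonneg_right hC₂le (Nat.cast_nonneg _))
  have hC₄'' : ∀ (W' : Finset ℝ) (D' : ℝ), 1 ≤ D' →
      ∫ u, gW W' u ^ 2 ≤ C₄' * D' * addEnergy W' + C₄' * D' / D' ^ j * (W'.card : ℝ) ^ 4 := by
    intro W' D' hD'
    have h0 : ∫ u, gW W' u ^ 2 ≤ C₄ * D' * addEnergy W' + C₄ * D' / D' ^ j * (W'.card : ℝ) ^ 4 := hC₄ W' D' hD'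
    have hE' := addEnergy_nonneg W'
    have hD0 : 0 ≤ D' := by linarith
    have t1 : C₄ * D' * addEnergy W' ≤ C₄' * D' * addEnergy W' :=
      mul_le_mul_of_nonneg_right (mul_le_mul_of_nonneg_right hC₄le hD0) hE'
    have t2 : C₄ * D' / D' ^ j * (W'.card : ℝ) ^ 4 ≤ C₄' * D' / D' ^ j * (W'.card : ℝ) ^ 4 :=
      mul_le_mul_of_nonneg_right (div_le_div_of_nonneg_right (mul_le_mul_of_nonneg_right hC₄le hD0) (by positivity))
        (by positivity)
    linarith
  clear hC₄ hC₂
  -- the two block estimates, specialised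
  have hblk₂ := hC_b N hNnat W M₀ i₁ i₂ i₃
  have hblk₁ := hC_b' N hNnat W M₀ i₁ i₂ i₃
  clear hC_b hC_b'
  -- abbreviations
  have hK0 : 0 ≤ (W.card : ℝ) := Nat.cast_nonneg _
  have hE0 : 0 ≤ addEnergy W := addEnergy_nonneg W
  set 𝒯 : ℝ := T ^ 2 * (W.card : ℝ) ^ (1 / 2 : ℝ) * (addEnergy W) ^ (1 / 2 : ℝ) with h𝒯
  have h𝒯0 : 0 ≤ 𝒯 := by rw [h𝒯]; positivity
  set negl : ℝ := (9 / 4 * D + Cmb) * ((N : ℝ) ^ 3 * (W.card : ℝ) ^ 3 * (N : ℝ) ^ (-(η * j))) with hnegl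
  have hnegl0 : 0 ≤ negl := by rw [hnegl]; positivity
  have hALT : 0 ≤ A₁ * ((N : ℝ) ^ η) ^ 4 * 𝒯 := by positivity
  set S := shell M₀ i₁ ×ˢ (shell M₀ i₂ ×ˢ shell M₀ i₃)
  by_cases hfar : max i₁ i₂ + 5 ≤ i₃
  · -- negligible block
    have hterm : ∀ m ∈ S, ‖Im w N W m‖ ≤ negl := by
      intro m hm
      refine (hD N W m).trans ((majorant_le_of_far_block hD0 j N W hfar hm).trans ?_)
      have h1 : D / (1 + (N : ℝ)) ^ j ≤ D * (N : ℝ) ^ (-(η * j)) := by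
        rw [div_eq_mul_inv]
        refine mul_le_mul_of_nonneg_left ?_ hD0
        rw [Real.rpow_neg hn0.le]
        refine inv_anti₀ (by positivity) ?_
        calc (N : ℝ) ^ (η * j) = ((N : ℝ) ^ η) ^ j := by rw [Real.rpow_mul hn0.le, Real.rpow_natCast]
          _ ≤ (1 + (N : ℝ)) ^ j := pow_le_pow_left₀ (by positivity) (by linarith [hLN]) j
      calc (N : ℝ) ^ 3 * (9 / 4 * (W.card : ℝ) ^ 3 * (D / (1 + (N : ℝ)) ^ j))
          ≤ (N : ℝ) ^ 3 * (9 / 4 * (W.card : ℝ) ^ 3 * (D * (N : ℝ) ^ (-(η * j)))) := by gcongr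
        _ = (9 / 4 * D) * ((N : ℝ) ^ 3 * (W.card : ℝ) ^ 3 * (N : ℝ) ^ (-(η * j))) := by ring
        _ ≤ (9 / 4 * D + Cmb) * ((N : ℝ) ^ 3 * (W.card : ℝ) ^ 3 * (N : ℝ) ^ (-(η * j))) := by
            gcongr; linarith
    calc ∑ m ∈ S, ‖Im w N W m‖ ≤ ∑ m ∈ S, negl := Finset.sum_le_sum hterm
      _ = (S.card : ℝ) * negl := by rw [Finset.sum_const, nsmul_eq_mul]
      _ ≤ A₁ * ((N : ℝ) ^ η) ^ 4 * 𝒯 + (S.card : ℝ) * negl := by linarith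
  · rw [not_le] at hfar
    rcases le_or_gt i₁ i₂ with h12 | h12
    · -- localise in `v₂`: `|m₂| ≥ 2^{i₂}`
      have hmain := simple_block (C_b := Cmb) (ia := i₁) (ib := i₂) (i₃ := i₃) hη0 hC₂'1 hC₄'1 hηj hC₄'' hCmb0
        hn1 hNT hTA W hC₂'' hKT hNM₀ h12 (by omega) hi₂
      have hX0 : 0 ≤ (∫ u, gW W u) ^ (1 / 2 : ℝ) *
          (4 * Jfun (fB W ((N : ℝ) * 2 ^ i₂ / (N : ℝ) ^ η)) (shell M₀ i₃) (shell M₀ i₂) (2 ^ (i₁ + 1))) ^ (1 / 4 : ℝ) *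
          (Jfun (fB W ((N : ℝ) * 2 ^ i₂ / (N : ℝ) ^ η)) (shell M₀ i₁) (shell M₀ i₂) (2 ^ (i₃ + 1))) ^ (1 / 4 : ℝ) :=
        mul_nonneg (mul_nonneg (Real.rpow_nonneg (integral_nonneg (gW_nonneg W)) _)
          (Real.rpow_nonneg (mul_nonneg (by norm_num) (integral_nonneg fun u ↦ sq_nonneg _)) _))
          (Real.rpow_nonneg (integral_nonneg fun u ↦ sq_nonneg _) _)
      have hQ0 : 0 ≤ (N : ℝ) ^ 3 / ((N : ℝ) * 2 ^ i₂ / (N : ℝ) ^ η) := by positivity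
      set X : ℝ := (∫ u, gW W u) ^ (1 / 2 : ℝ) *
          (4 * Jfun (fB W ((N : ℝ) * 2 ^ i₂ / (N : ℝ) ^ η)) (shell M₀ i₃) (shell M₀ i₂) (2 ^ (i₁ + 1))) ^ (1 / 4 : ℝ) *
          (Jfun (fB W ((N : ℝ) * 2 ^ i₂ / (N : ℝ) ^ η)) (shell M₀ i₁) (shell M₀ i₂) (2 ^ (i₃ + 1))) ^ (1 / 4 : ℝ)
      set Q : ℝ := (N : ℝ) ^ 3 / ((N : ℝ) * 2 ^ i₂ / (N : ℝ) ^ η)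
      have hmain' : Cmb * Q * X ≤ A₁ * ((N : ℝ) ^ η) ^ 4 * 𝒯 := hmain
      have hblk' : ∑ m ∈ S, ‖Im w N W m‖ ≤ C_b * Q * X +
          C_b * (S.card : ℝ) * ((N : ℝ) ^ 3 * (W.card : ℝ) ^ 3 * (N : ℝ) ^ (-(η * j))) := hblk₂
      have hCb1 : C_b * Q * X ≤ Cmb * Q * X :=
        mul_le_mul_of_nonneg_right (mul_le_mul_of_nonneg_right hCb_le hQ0) hX0
      have hCb2 : C_b * (S.card : ℝ) * ((N : ℝ) ^ 3 * (W.card : ℝ) ^ 3 * (N : ℝ) ^ (-(η * j))) ≤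
          (S.card : ℝ) * negl := by
        have h1 : C_b ≤ 9 / 4 * D + Cmb := by linarith
        calc C_b * (S.card : ℝ) * ((N : ℝ) ^ 3 * (W.card : ℝ) ^ 3 * (N : ℝ) ^ (-(η * j)))
            = (S.card : ℝ) * (C_b * ((N : ℝ) ^ 3 * (W.card : ℝ) ^ 3 * (N : ℝ) ^ (-(η * j)))) := by ring
          _ ≤ (S.card : ℝ) * ((9 / 4 * D + Cmb) * ((N : ℝ) ^ 3 * (W.card : ℝ) ^ 3 * (N : ℝ) ^ (-(η * j)))) :=
              mul_le_mul_of_nonneg_left (mul_le_mul_of_nonneg_right h1 (by positivity)) (Nat.cast_nonneg _)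
      linarith only [hblk', hmain', hCb1, hCb2]
    · -- localise in `v₁`: `|m₁| ≥ 2^{i₁}`
      have hmain := simple_block (C_b := Cmb) (ia := i₂) (ib := i₁) (i₃ := i₃) hη0 hC₂'1 hC₄'1 hηj hC₄'' hCmb0
        hn1 hNT hTA W hC₂'' hKT hNM₀ h12.le (by omega) hi₁
      have hX0 : 0 ≤ (∫ u, gW W u) ^ (1 / 2 : ℝ) *
          (4 * Jfun (fB W ((N : ℝ) * 2 ^ i₁ / (N : ℝ) ^ η)) (shell M₀ i₃) (shell M₀ i₁) (2 ^ (i₂ + 1))) ^ (1 / 4 : ℝ) *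
          (Jfun (fB W ((N : ℝ) * 2 ^ i₁ / (N : ℝ) ^ η)) (shell M₀ i₂) (shell M₀ i₁) (2 ^ (i₃ + 1))) ^ (1 / 4 : ℝ) :=
        mul_nonneg (mul_nonneg (Real.rpow_nonneg (integral_nonneg (gW_nonneg W)) _)
          (Real.rpow_nonneg (mul_nonneg (by norm_num) (integral_nonneg fun u ↦ sq_nonneg _)) _))
          (Real.rpow_nonneg (integral_nonneg fun u ↦ sq_nonneg _) _)
      have hQ0 : 0 ≤ (N : ℝ) ^ 3 / ((N : ℝ) * 2 ^ i₁ / (N : ℝ) ^ η) := by positivity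
      set X : ℝ := (∫ u, gW W u) ^ (1 / 2 : ℝ) *
          (4 * Jfun (fB W ((N : ℝ) * 2 ^ i₁ / (N : ℝ) ^ η)) (shell M₀ i₃) (shell M₀ i₁) (2 ^ (i₂ + 1))) ^ (1 / 4 : ℝ) *
          (Jfun (fB W ((N : ℝ) * 2 ^ i₁ / (N : ℝ) ^ η)) (shell M₀ i₂) (shell M₀ i₁) (2 ^ (i₃ + 1))) ^ (1 / 4 : ℝ)
      set Q : ℝ := (N : ℝ) ^ 3 / ((N : ℝ) * 2 ^ i₁ / (N : ℝ) ^ η)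
      have hmain' : Cmb * Q * X ≤ A₁ * ((N : ℝ) ^ η) ^ 4 * 𝒯 := hmain
      have hblk' : ∑ m ∈ S, ‖Im w N W m‖ ≤ C_b' * Q * X +
          C_b' * (S.card : ℝ) * ((N : ℝ) ^ 3 * (W.card : ℝ) ^ 3 * (N : ℝ) ^ (-(η * j))) := hblk₁
      have hCb1 : C_b' * Q * X ≤ Cmb * Q * X :=
        mul_le_mul_of_nonneg_right (mul_le_mul_of_nonneg_right hCb'_le hQ0) hX0
      have hCb2 : C_b' * (S.card : ℝ) * ((N : ℝ) ^ 3 * (W.card : ℝ) ^ 3 * (N : ℝ) ^ (-(η * j))) ≤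
          (S.card : ℝ) * negl := by
        have h1 : C_b' ≤ 9 / 4 * D + Cmb := by linarith
        calc C_b' * (S.card : ℝ) * ((N : ℝ) ^ 3 * (W.card : ℝ) ^ 3 * (N : ℝ) ^ (-(η * j)))
            = (S.card : ℝ) * (C_b' * ((N : ℝ) ^ 3 * (W.card : ℝ) ^ 3 * (N : ℝ) ^ (-(η * j)))) := by ring
          _ ≤ (S.card : ℝ) * ((9 / 4 * D + Cmb) * ((N : ℝ) ^ 3 * (W.card : ℝ) ^ 3 * (N : ℝ) ^ (-(η * j)))) :=
              mul_le_mul_of_nonneg_left (mul_le_mul_of_nonneg_right h1 (by positivity)) (Nat.cast_nonneg _)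
      linarith only [hblk', hmain', hCb1, hCb2]



/-! ## §7. The range `T ≤ N⁶`: assembly of the blocks -/

set_option maxHeartbeats 1600000 in
/-- **Proposition 8.1 in the range `N ≤ T ≤ N⁶`** (with `N^δ`-losses): for every `δ > 0` there is `C`
such that `|S₃| ≤ C N^δ · T²|W|^{1/2}E(W)^{1/2}` whenever `1 ≤ N ≤ T ≤ N⁶` and `W ⊂ [t₀, t₀+T]` is
`1`-separated. Proof: `η = min(1/2, δ/22)`, `j = ⌈40/η⌉ + 1`, `M₀ = ⌈(1+T)N^{η−1}⌉`; the truncation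
(7.2) (`trunc_total_freeT`), the `O(N^{18η})` dyadic blocks of Proposition 7.2 each bounded by
`simple_block_bound` (Hölder, change of variables, Lemmas 8.2 and 8.3, `M ⪅ T/N`), the negligible
total `|𝓜³| N³|W|³N^{-ηj} ≪ T²|W|^{3/2}`, and `|W|^{3/2} ≤ |W|^{1/2}E(W)^{1/2}` (`|W|² ≤ E(W)`).
[cite: GuthMaynard2026, proof of Proposition 8.1] -/
theorem S3_simple_bound_of_le_pow_six {w : ℝ → ℝ} (hw : ContDiff ℝ ∞ w) (hsupp : Function.support w ⊆ Set.Icc 1 2)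
    (δ : ℝ) (hδ : 0 < δ) :
    ∃ C, 0 ≤ C ∧ ∀ N : ℕ, (1 : ℝ) ≤ (N : ℝ) → ∀ T : ℝ, (N : ℝ) ≤ T → T ≤ (N : ℝ) ^ (6 : ℝ) →
      ∀ (t₀ : ℝ) (W : Finset ℝ),
      (∀ t ∈ W, t₀ ≤ t ∧ t ≤ t₀ + T) →
      (∀ t ∈ W, ∀ t' ∈ W, t ≠ t' → 1 ≤ |t - t'|) →
      ‖S3 w N W‖ ≤ C * (N : ℝ) ^ δ *
        (T ^ 2 * (W.card : ℝ) ^ (1 / 2 : ℝ) * (addEnergy W) ^ (1 / 2 : ℝ)) := by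
  -- exponents
  obtain ⟨η, hη⟩ : ∃ η : ℝ, η = min (1 / 2) (δ / 22) := ⟨_, rfl⟩
  have hη0 : 0 < η := by rw [hη]; exact lt_min (by norm_num) (by positivity)
  have hη12 : η ≤ 1 / 2 := by rw [hη]; exact min_le_left _ _
  have hη1 : η ≤ 1 := by linarith
  have hηδ : 22 * η ≤ δ := by have := min_le_right (1 / 2 : ℝ) (δ / 22); rw [← hη] at this; linarith
  obtain ⟨j, hj⟩ : ∃ j : ℕ, j = ⌈40 / η⌉₊ + 1 := ⟨_, rfl⟩
  have hj2 : 2 ≤ j := by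
    have : 1 ≤ ⌈40 / η⌉₊ := Nat.one_le_iff_ne_zero.mpr (Nat.ceil_pos.mpr (by positivity)).ne'
    omega
  have hηj1 : 40 ≤ η * ((j : ℝ) - 1) := by
    have h1 : ((j : ℝ) - 1) = (⌈40 / η⌉₊ : ℝ) := by rw [hj]; push_cast; ring
    have h2 : 40 / η ≤ (⌈40 / η⌉₊ : ℝ) := Nat.le_ceil _
    rw [h1]
    calc (40 : ℝ) = η * (40 / η) := by field_simp
      _ ≤ η * (⌈40 / η⌉₊ : ℝ) := by gcongr
  have hηjA : 1 + 6 * (6 : ℝ) + 6 * η ≤ η * j := by nlinarith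
  have hηjB : 2 * (6 : ℝ) ≤ η * ((j : ℝ) - 1) := by linarith
  have hηj18 : 18 + 3 * η ≤ η * j := by nlinarith
  -- constants
  obtain ⟨A₄, hA₄0, hA₄⟩ := trunc_total_freeT hw hsupp (A := 6) hη0 hj2 hηjA
  obtain ⟨A₁, Cn, hA₁0, hCn0, hblock⟩ := simple_block_bound hw hsupp (A := 6) hη0 hη1 j hηjB
  set A₂ : ℝ := (1 + 6 / η) ^ 3 * A₁ with hA₂
  set A₃ : ℝ := 27 * 27 * Cn * 4 with hA₃
  have hA₂0 : 0 ≤ A₂ := by rw [hA₂]; positivity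
  have hA₃0 : 0 ≤ A₃ := by rw [hA₃]; positivity
  refine ⟨A₂ + A₃ + A₄, by positivity, ?_⟩
  intro N hn1 T hNT hTA t₀ W hW hsep1
  -- basic quantities
  have hn0 : (0 : ℝ) < N := by linarith
  have hNnat : 1 ≤ N := by exact_mod_cast hn1
  have hnle : ∀ {x y : ℝ}, x ≤ y → (N : ℝ) ^ x ≤ (N : ℝ) ^ y := fun h ↦ Real.rpow_le_rpow_of_exponent_le hn1 h
  have hnp : ∀ x y : ℝ, (N : ℝ) ^ x * (N : ℝ) ^ y = (N : ℝ) ^ (x + y) := fun x y ↦ (Real.rpow_add hn0 x y).symm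
  have hn1le : ∀ {x : ℝ}, 0 ≤ x → 1 ≤ (N : ℝ) ^ x := fun h ↦ Real.one_le_rpow hn1 h
  have hT1 : 1 ≤ T := hn1.trans hNT
  have hT0 : 0 < T := by linarith
  have hK0 : 0 ≤ (W.card : ℝ) := Nat.cast_nonneg _
  have hE0 : 0 ≤ addEnergy W := addEnergy_nonneg W
  have hKE : (W.card : ℝ) ^ 2 ≤ addEnergy W := GuthMaynardEnergyBound.card_sq_le_energy W
  have hKT : (W.card : ℝ) ≤ 2 * T := by
    have h := SeparatedSums.card_le_of_sep one_pos (by linarith) W hW hsep1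
    rw [div_one] at h
    linarith
  set L : ℝ := (N : ℝ) ^ η with hL
  have hL1 : 1 ≤ L := hn1le hη0.le
  have hL0 : 0 < L := by linarith
  have hT6 : T ≤ (N : ℝ) ^ 6 := by
    have := hTA; rwa [show (6 : ℝ) = (6 : ℕ) by norm_num, Real.rpow_natCast] at this
  -- `M₀`
  set M₀ : ℕ := ⌈(1 + T) * (N : ℝ) ^ (η - 1)⌉₊
  have hM₀pos : 0 < (1 + T) * (N : ℝ) ^ (η - 1) := by positivity
  have hM₀1 : 1 ≤ M₀ := Nat.one_le_iff_ne_zero.mpr (Nat.ceil_pos.mpr hM₀pos).ne'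
  have hM₀r : (1 : ℝ) ≤ M₀ := by exact_mod_cast hM₀1
  have hM₀lo : (1 + T) * (N : ℝ) ^ (η - 1) ≤ M₀ := Nat.le_ceil _
  have hM₀hi : (M₀ : ℝ) ≤ (1 + T) * (N : ℝ) ^ (η - 1) + 1 := (Nat.ceil_lt_add_one hM₀pos.le).le
  have hNη1 : (N : ℝ) * (N : ℝ) ^ (η - 1) = L := by
    rw [hL, show (N : ℝ) * (N : ℝ) ^ (η - 1) = (N : ℝ) ^ (1 : ℝ) * (N : ℝ) ^ (η - 1) by rw [Real.rpow_one], hnp]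
    ring_nf
  have hNM₀ : (N : ℝ) * M₀ ≤ 3 * T * L := by
    calc (N : ℝ) * M₀ ≤ (N : ℝ) * ((1 + T) * (N : ℝ) ^ (η - 1) + 1) := by gcongr
      _ = (1 + T) * ((N : ℝ) * (N : ℝ) ^ (η - 1)) + N := by ring
      _ = (1 + T) * L + N := by rw [hNη1]
      _ ≤ (T + T) * L + T * L := by
          gcongr
          calc (N : ℝ) = N * 1 := (mul_one _).symm
            _ ≤ T * L := by gcongr
      _ = 3 * T * L := by ring
  have hNM₀' : (1 + T) * L ≤ (N : ℝ) * M₀ := by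
    calc (1 + T) * L = (N : ℝ) * ((1 + T) * (N : ℝ) ^ (η - 1)) := by rw [← hNη1]; ring
      _ ≤ (N : ℝ) * M₀ := by gcongr
  have hN3r : (((N ^ 3 : ℕ)) : ℝ) = (N : ℝ) ^ 3 := by push_cast; ring
  have hn1' : (1 : ℝ) ≤ ((N ^ 3 : ℕ) : ℝ) := by rw [hN3r]; exact one_le_pow₀ hn1
  have hM₀T : (M₀ : ℝ) ≤ 3 * (((N ^ 3 : ℕ)) : ℝ) ^ 2 := by
    rw [hN3r]
    have h1 : (N : ℝ) ^ (η - 1) ≤ 1 := Real.rpow_le_one_of_one_le_of_nonpos hn1 (by linarith)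
    have h2 : (M₀ : ℝ) ≤ (1 + T) * 1 + 1 := hM₀hi.trans (by gcongr)
    have h3 : ((N : ℝ) ^ 3) ^ 2 = (N : ℝ) ^ 6 := by ring
    rw [h3]
    calc (M₀ : ℝ) ≤ (1 + T) * 1 + 1 := h2
      _ = T + 2 := by ring
      _ ≤ 3 * T := by linarith
      _ ≤ 3 * (N : ℝ) ^ 6 := by gcongr
  -- Step 1: truncation
  have htrunc : ‖S3 w N W - ∑ m ∈ Mset M₀ ×ˢ (Mset M₀ ×ˢ Mset M₀), Im w N W m‖ ≤
      A₄ * (T ^ 2 * (W.card : ℝ) ^ (3 / 2 : ℝ)) := hA₄ N hn1 T hNT hTA t₀ W hW hKT M₀ hM₀1 hNM₀' hNM₀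
  -- Step 2: the blocks
  set R := Finset.range (Nat.log 2 M₀ + 1) with hR
  set 𝒯 : ℝ := T ^ 2 * (W.card : ℝ) ^ (1 / 2 : ℝ) * (addEnergy W) ^ (1 / 2 : ℝ) with h𝒯
  have h𝒯0 : 0 ≤ 𝒯 := by rw [h𝒯]; positivity
  set negl : ℝ := Cn * ((N : ℝ) ^ 3 * (W.card : ℝ) ^ 3 * (N : ℝ) ^ (-(η * j))) with hnegl
  have hnegl0 : 0 ≤ negl := by rw [hnegl]; positivity
  have hpow2 : ∀ {i : ℕ}, i ∈ R → (2 : ℝ) ^ i ≤ M₀ := by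
    intro i hi
    rw [hR, Finset.mem_range, Nat.lt_succ_iff] at hi
    have : 2 ^ i ≤ M₀ := (Nat.pow_le_pow_right (by norm_num) hi).trans (Nat.pow_log_le_self 2 (by omega))
    exact_mod_cast this
  have hblock' : ∀ b ∈ R ×ˢ (R ×ˢ R),
      ∑ m ∈ shell M₀ b.1 ×ˢ (shell M₀ b.2.1 ×ˢ shell M₀ b.2.2), ‖Im w N W m‖ ≤ A₁ * L ^ 4 * 𝒯 +
        ((shell M₀ b.1 ×ˢ (shell M₀ b.2.1 ×ˢ shell M₀ b.2.2)).card : ℝ) * negl := by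
    rintro ⟨i₁, i₂, i₃⟩ hb
    simp only [Finset.mem_product] at hb
    obtain ⟨hi₁, hi₂, -⟩ := hb
    exact hblock N hn1 T hNT hTA t₀ W hW hsep1 M₀ hNM₀ i₁ i₂ i₃ (hpow2 hi₁) (hpow2 hi₂)
  -- sum over the blocks
  have hsum := sum_Mset3_eq_sum_blocks M₀ (fun m ↦ ‖Im w N W m‖)
  have hcard_blocks : ∑ b ∈ R ×ˢ (R ×ˢ R), ((shell M₀ b.1 ×ˢ (shell M₀ b.2.1 ×ˢ shell M₀ b.2.2)).card : ℝ) =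
      ((Mset M₀ ×ˢ (Mset M₀ ×ˢ Mset M₀)).card : ℝ) := by
    have h := sum_Mset3_eq_sum_blocks M₀ (fun _ ↦ (1 : ℝ))
    simp only [Finset.sum_const, nsmul_eq_mul, mul_one] at h
    rw [hR]; exact h.symm
  have hMset_card : ((Mset M₀ ×ˢ (Mset M₀ ×ˢ Mset M₀)).card : ℝ) ≤ (3 * (M₀ : ℝ)) ^ 3 := card_Mset3_le hM₀1
  have eL6 : (((N ^ 3 : ℕ) : ℝ) ^ η) ^ 2 = L ^ 6 := by
    rw [hN3r, hL, ← Real.rpow_natCast (N : ℝ) 3, ← Real.rpow_mul hn0.le, ← Real.rpow_natCast, ← Real.rpow_natCast,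
      ← Real.rpow_mul hn0.le, ← Real.rpow_mul hn0.le]
    congr 1; push_cast; ring
  have hRcard : ((R ×ˢ (R ×ˢ R)).card : ℝ) ≤ ((1 + 6 / η) * L ^ 6) ^ 3 := by
    have h := card_blocks_le hη0 hη1 hn1' hM₀1 hM₀T
    rw [eL6] at h
    rw [hR]; exact h
  have hALT : 0 ≤ A₁ * L ^ 4 * 𝒯 := by positivity
  have hblocks_total : ∑ m ∈ Mset M₀ ×ˢ (Mset M₀ ×ˢ Mset M₀), ‖Im w N W m‖ ≤
      ((1 + 6 / η) * L ^ 6) ^ 3 * (A₁ * L ^ 4 * 𝒯) + (3 * (M₀ : ℝ)) ^ 3 * negl := by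
    rw [hsum, ← hR]
    calc ∑ b ∈ R ×ˢ (R ×ˢ R), ∑ m ∈ shell M₀ b.1 ×ˢ (shell M₀ b.2.1 ×ˢ shell M₀ b.2.2), ‖Im w N W m‖
        ≤ ∑ b ∈ R ×ˢ (R ×ˢ R), (A₁ * L ^ 4 * 𝒯 +
            ((shell M₀ b.1 ×ˢ (shell M₀ b.2.1 ×ˢ shell M₀ b.2.2)).card : ℝ) * negl) := Finset.sum_le_sum hblock'
      _ = ((R ×ˢ (R ×ˢ R)).card : ℝ) * (A₁ * L ^ 4 * 𝒯) +
            (∑ b ∈ R ×ˢ (R ×ˢ R), ((shell M₀ b.1 ×ˢ (shell M₀ b.2.1 ×ˢ shell M₀ b.2.2)).card : ℝ)) * negl := by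
          rw [Finset.sum_add_distrib, Finset.sum_const, nsmul_eq_mul, ← Finset.sum_mul]
      _ ≤ ((1 + 6 / η) * L ^ 6) ^ 3 * (A₁ * L ^ 4 * 𝒯) + (3 * (M₀ : ℝ)) ^ 3 * negl := by
          rw [hcard_blocks]
          gcongr
  -- `T²|W|^{3/2} ≤ 𝒯`
  have hK32 : (W.card : ℝ) ^ (3 / 2 : ℝ) ≤ (W.card : ℝ) ^ (1 / 2 : ℝ) * (addEnergy W) ^ (1 / 2 : ℝ) :=
    rpow_three_halves_le hK0 hKE
  have hT𝒯 : T ^ 2 * (W.card : ℝ) ^ (3 / 2 : ℝ) ≤ 𝒯 := by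
    calc T ^ 2 * (W.card : ℝ) ^ (3 / 2 : ℝ) ≤ T ^ 2 * ((W.card : ℝ) ^ (1 / 2 : ℝ) * (addEnergy W) ^ (1 / 2 : ℝ)) := by
          gcongr
      _ = 𝒯 := by rw [h𝒯]; ring
  -- the negligible total is `≤ A₃ T² |W|^{3/2} ≤ A₃ 𝒯`
  have hK3 : (W.card : ℝ) ^ 3 ≤ 4 * T ^ 2 * (W.card : ℝ) ^ (3 / 2 : ℝ) := cube_le hK0 hT1 hKT
  have hpow3 : T ^ 3 * L ^ 3 * (N : ℝ) ^ (-(η * j)) ≤ 1 := by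
    have hT3 : T ^ 3 ≤ (N : ℝ) ^ (18 : ℝ) := by
      calc T ^ 3 ≤ ((N : ℝ) ^ (6 : ℝ)) ^ 3 := pow_le_pow_left₀ hT0.le hTA 3
        _ = (N : ℝ) ^ (18 : ℝ) := by rw [← Real.rpow_natCast, ← Real.rpow_mul hn0.le]; norm_num
    have eL : L ^ 3 = (N : ℝ) ^ (η * 3) := by rw [hL, ← Real.rpow_natCast, ← Real.rpow_mul hn0.le]; norm_num
    calc T ^ 3 * L ^ 3 * (N : ℝ) ^ (-(η * j)) ≤ (N : ℝ) ^ (18 : ℝ) * L ^ 3 * (N : ℝ) ^ (-(η * j)) := by gcongr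
      _ = (N : ℝ) ^ (18 + η * 3 + -(η * j)) := by rw [eL, hnp, hnp]
      _ ≤ (N : ℝ) ^ (0 : ℝ) := hnle (by linarith)
      _ = 1 := Real.rpow_zero _
  have hnegl_total : (3 * (M₀ : ℝ)) ^ 3 * negl ≤ A₃ * 𝒯 := by
    have hM₀3 : (3 * (M₀ : ℝ)) ^ 3 * (N : ℝ) ^ 3 ≤ 27 * (3 * T * L) ^ 3 := by
      calc (3 * (M₀ : ℝ)) ^ 3 * (N : ℝ) ^ 3 = 27 * ((N : ℝ) * M₀) ^ 3 := by ring
        _ ≤ 27 * (3 * T * L) ^ 3 := by gcongr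
    calc (3 * (M₀ : ℝ)) ^ 3 * negl
        = Cn * ((3 * (M₀ : ℝ)) ^ 3 * (N : ℝ) ^ 3) * (W.card : ℝ) ^ 3 * (N : ℝ) ^ (-(η * j)) := by
          simp only [hnegl]; ring
      _ ≤ Cn * (27 * (3 * T * L) ^ 3) * (4 * T ^ 2 * (W.card : ℝ) ^ (3 / 2 : ℝ)) * (N : ℝ) ^ (-(η * j)) := by
          gcongr
      _ = A₃ * (T ^ 2 * (W.card : ℝ) ^ (3 / 2 : ℝ)) * (T ^ 3 * L ^ 3 * (N : ℝ) ^ (-(η * j))) := by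
          simp only [hA₃]; ring
      _ ≤ A₃ * 𝒯 * 1 := by gcongr
      _ = _ := mul_one _
  -- the main total is `≤ A₂ N^δ 𝒯`
  have hLδ : L ^ 22 ≤ (N : ℝ) ^ δ := by
    rw [hL, ← Real.rpow_natCast, ← Real.rpow_mul hn0.le]
    exact hnle (by push_cast; nlinarith)
  have hNδ1 : 1 ≤ (N : ℝ) ^ δ := hn1le hδ.le
  have hmain_total : ((1 + 6 / η) * L ^ 6) ^ 3 * (A₁ * L ^ 4 * 𝒯) ≤ A₂ * (N : ℝ) ^ δ * 𝒯 := by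
    calc ((1 + 6 / η) * L ^ 6) ^ 3 * (A₁ * L ^ 4 * 𝒯) = A₂ * L ^ 22 * 𝒯 := by simp only [hA₂]; ring
      _ ≤ A₂ * (N : ℝ) ^ δ * 𝒯 := by gcongr
  -- assemble
  have hsplit : ‖S3 w N W‖ ≤ ‖S3 w N W - ∑ m ∈ Mset M₀ ×ˢ (Mset M₀ ×ˢ Mset M₀), Im w N W m‖ +
      ∑ m ∈ Mset M₀ ×ˢ (Mset M₀ ×ˢ Mset M₀), ‖Im w N W m‖ := by
    calc ‖S3 w N W‖ = ‖(S3 w N W - ∑ m ∈ Mset M₀ ×ˢ (Mset M₀ ×ˢ Mset M₀), Im w N W m) +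
          ∑ m ∈ Mset M₀ ×ˢ (Mset M₀ ×ˢ Mset M₀), Im w N W m‖ := by rw [sub_add_cancel]
      _ ≤ ‖S3 w N W - ∑ m ∈ Mset M₀ ×ˢ (Mset M₀ ×ˢ Mset M₀), Im w N W m‖ +
          ‖∑ m ∈ Mset M₀ ×ˢ (Mset M₀ ×ˢ Mset M₀), Im w N W m‖ := norm_add_le _ _
      _ ≤ _ := by gcongr; exact norm_sum_le _ _
  have htrunc' : ‖S3 w N W - ∑ m ∈ Mset M₀ ×ˢ (Mset M₀ ×ˢ Mset M₀), Im w N W m‖ ≤ A₄ * 𝒯 :=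
    htrunc.trans (mul_le_mul_of_nonneg_left hT𝒯 hA₄0)
  have hfin : ‖S3 w N W‖ ≤ A₄ * 𝒯 + (A₂ * (N : ℝ) ^ δ * 𝒯 + A₃ * 𝒯) := by
    linarith [hsplit, htrunc', hblocks_total, hnegl_total, hmain_total]
  calc ‖S3 w N W‖ ≤ A₄ * 𝒯 + (A₂ * (N : ℝ) ^ δ * 𝒯 + A₃ * 𝒯) := hfin
    _ ≤ A₄ * ((N : ℝ) ^ δ * 𝒯) + (A₂ * (N : ℝ) ^ δ * 𝒯 + A₃ * ((N : ℝ) ^ δ * 𝒯)) := by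
        have h1 : 𝒯 ≤ (N : ℝ) ^ δ * 𝒯 := by
          calc 𝒯 = 1 * 𝒯 := (one_mul _).symm
            _ ≤ (N : ℝ) ^ δ * 𝒯 := by gcongr
        gcongr
    _ = (A₂ + A₃ + A₄) * (N : ℝ) ^ δ * 𝒯 := by ring

/-! ## §8. Proposition 8.1 with `T` free -/

/-- **Guth–Maynard Proposition 8.1 (`S₃` controlled by the energy), as printed with `T` free**:
for every admissible cutoff `w` (§3 of the paper) and every `ε, δ > 0` there are `C, T₀` such that for
all `T ≥ T₀`, all `1 ≤ N ≤ T` and every `T^ε`-separated `W` in an interval of length `T`,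
`|S₃| ≤ C T^δ · T²|W|^{1/2}E(W)^{1/2}` ("If `W` is a `T^ε`-separated set contained in an interval of
length `T`, then `S₃ ⪅_ε T²|W|^{1/2}E(W)^{1/2}`"). Proof: for `N⁶ ≤ T` the trivial bound
`|S₃| ≪ N³|W|³ ≤ T^{1/2}|W|³ ≪ T²|W|^{1/2}E(W)^{1/2}` (`norm_S3_le_trivial`, `|W| ≤ 2T`,
`|W|² ≤ E(W)`); for `T ≤ N⁶` the printed §8 argument (`S3_simple_bound_of_le_pow_six`) with `N^δ ≤ T^δ`.
The `T^ε`-separation is used only through `1`-separation (`T ≥ 1`).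
[cite: GuthMaynard2026, Proposition 8.1] -/
theorem S3_simple_bound (w : ℝ → ℝ) (hw : ContDiff ℝ ∞ w) (hsupp : Function.support w ⊆ Set.Icc 1 2)
    (_hw1 : ∀ u : ℝ, 6 / 5 ≤ u → u ≤ 9 / 5 → w u = 1) (_hw01 : ∀ u : ℝ, 0 ≤ w u ∧ w u ≤ 1)
    (ε : ℝ) (hε : 0 < ε) (δ : ℝ) (hδ : 0 < δ) :
    ∃ C T₀ : ℝ, ∀ T : ℝ, T₀ ≤ T → ∀ N : ℕ, 1 ≤ N → (N : ℝ) ≤ T → ∀ (t₀ : ℝ) (W : Finset ℝ),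
      (∀ t ∈ W, t₀ ≤ t ∧ t ≤ t₀ + T) →
      (∀ t ∈ W, ∀ t' ∈ W, t ≠ t' → T ^ ε ≤ |t - t'|) →
      ‖S3 w N W‖ ≤ C * T ^ δ * (T ^ 2 * (W.card : ℝ) ^ (1 / 2 : ℝ) * (addEnergy W) ^ (1 / 2 : ℝ)) := by
  obtain ⟨C₁, hC₁0, hC₁⟩ := norm_S3_le_trivial hw hsupp
  obtain ⟨C₂, hC₂0, hC₂⟩ := S3_simple_bound_of_le_pow_six hw hsupp δ hδ
  refine ⟨3 * C₁ + C₂, 1, fun T hT1 N hN hNT t₀ W hW hsep ↦ ?_⟩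
  have hT0 : 0 < T := by linarith
  have hn1 : (1 : ℝ) ≤ N := by exact_mod_cast hN
  have hn0 : (0 : ℝ) < N := by linarith
  have hsep1 : ∀ t ∈ W, ∀ t' ∈ W, t ≠ t' → 1 ≤ |t - t'| := by
    intro t ht t' ht' hne
    have h1 := hsep t ht t' ht' hne
    have h2 : 1 ≤ T ^ ε := Real.one_le_rpow hT1 hε.le
    linarith
  have hK0 : 0 ≤ (W.card : ℝ) := Nat.cast_nonneg _
  have hE0 : 0 ≤ addEnergy W := addEnergy_nonneg W
  have hKE : (W.card : ℝ) ^ 2 ≤ addEnergy W := GuthMaynardEnergyBound.card_sq_le_energy W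
  have hKT : (W.card : ℝ) ≤ 2 * T := by
    have h := SeparatedSums.card_le_of_sep one_pos (by linarith) W hW hsep1
    rw [div_one] at h
    linarith
  have hTδ1 : 1 ≤ T ^ δ := Real.one_le_rpow hT1 hδ.le
  set 𝒯 : ℝ := T ^ 2 * (W.card : ℝ) ^ (1 / 2 : ℝ) * (addEnergy W) ^ (1 / 2 : ℝ) with h𝒯
  have h𝒯0 : 0 ≤ 𝒯 := by rw [h𝒯]; positivity
  rcases le_or_gt T ((N : ℝ) ^ (6 : ℝ)) with hcase | hcase
  · -- the range `T ≤ N⁶`: §8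
    have h := hC₂ N hn1 T hNT hcase t₀ W hW hsep1
    have hNδ : (N : ℝ) ^ δ ≤ T ^ δ := Real.rpow_le_rpow hn0.le hNT hδ.le
    calc ‖S3 w N W‖ ≤ C₂ * (N : ℝ) ^ δ * 𝒯 := h
      _ ≤ C₂ * T ^ δ * 𝒯 := by gcongr
      _ ≤ (3 * C₁ + C₂) * T ^ δ * 𝒯 := by gcongr; linarith
  · -- the range `N⁶ ≤ T`: trivial bound
    have hN3 : (N : ℝ) ^ 3 ≤ T ^ (1 / 2 : ℝ) := by
      have h1 : ((N : ℝ) ^ (6 : ℝ)) ^ (1 / 2 : ℝ) ≤ T ^ (1 / 2 : ℝ) :=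
        Real.rpow_le_rpow (by positivity) hcase.le (by norm_num)
      rwa [← Real.rpow_mul hn0.le, show (6 : ℝ) * (1 / 2) = (3 : ℕ) by norm_num, Real.rpow_natCast] at h1
    have hK3 : (W.card : ℝ) ^ 3 ≤ 3 * T ^ (3 / 2 : ℝ) * ((W.card : ℝ) ^ (1 / 2 : ℝ) * (addEnergy W) ^ (1 / 2 : ℝ)) :=
      cube_le_energy hK0 hKT hKE
    have hT2 : T ^ (1 / 2 : ℝ) * T ^ (3 / 2 : ℝ) = T ^ 2 := by
      rw [← Real.rpow_add hT0]; norm_num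
    calc ‖S3 w N W‖ ≤ C₁ * (N : ℝ) ^ 3 * (W.card : ℝ) ^ 3 := hC₁ N hN W
      _ ≤ C₁ * T ^ (1 / 2 : ℝ) * (3 * T ^ (3 / 2 : ℝ) * ((W.card : ℝ) ^ (1 / 2 : ℝ) * (addEnergy W) ^ (1 / 2 : ℝ))) := by
          gcongr
      _ = 3 * C₁ * 1 * ((T ^ (1 / 2 : ℝ) * T ^ (3 / 2 : ℝ)) * (W.card : ℝ) ^ (1 / 2 : ℝ) * (addEnergy W) ^ (1 / 2 : ℝ)) := by
          ring
      _ ≤ 3 * C₁ * T ^ δ * 𝒯 := by rw [hT2, ← h𝒯]; gcongr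
      _ ≤ (3 * C₁ + C₂) * T ^ δ * 𝒯 := by gcongr; linarith

end GuthMaynardSimpleS3

/-! ## §9. The typed statement, proved along §8 -/

/-- **Second proof of the tree's `GuthMaynard2026_proposition_8_1`** (the case `T = N^{6/5}` of
Proposition 8.1, first discharged in `GuthMaynardEnergyLemma.lean` from Proposition 10.1): specialise the
free-`T` theorem `GuthMaynardSimpleS3.S3_simple_bound` (the printed §8 argument) to `T = N^{6/5}`,
`δ ↦ 5δ/6` (`(N^{6/5})^{5δ/6} = N^δ`), `N ≥ max(1, T₀)`. [cite: GuthMaynard2026, Proposition 8.1] -/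
theorem GuthMaynard2026_proposition_8_1_holds' : GuthMaynard2026_proposition_8_1 := by
  intro w hw hsupp hw1 hw01 ε hε δ hδ
  obtain ⟨C, T₀, hC⟩ := GuthMaynardSimpleS3.S3_simple_bound w hw hsupp hw1 hw01 ε hε (5 * δ / 6) (by positivity)
  refine ⟨C, max 1 T₀, fun N hN t₀ W hW hsep ↦ ?_⟩
  have hN1 : (1 : ℝ) ≤ N := (le_max_left _ _).trans hN
  have hNT₀ : T₀ ≤ (N : ℝ) := (le_max_right _ _).trans hN
  have hN0 : (0 : ℝ) ≤ N := by linarith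
  have hNnat : 1 ≤ N := by exact_mod_cast hN1
  set T : ℝ := (N : ℝ) ^ (6 / 5 : ℝ) with hT
  have hNT : (N : ℝ) ≤ T := by
    calc (N : ℝ) = (N : ℝ) ^ (1 : ℝ) := (Real.rpow_one _).symm
      _ ≤ T := Real.rpow_le_rpow_of_exponent_le hN1 (by norm_num)
  have hTT₀ : T₀ ≤ T := hNT₀.trans hNT
  have h := hC T hTT₀ N hNnat hNT t₀ W hW hsep
  have e : T ^ (5 * δ / 6) = (N : ℝ) ^ δ := by
    rw [hT, ← Real.rpow_mul hN0]; congr 1; ring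
  rwa [e] at h

end Literature.NumberTheory.LFunctions

end
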